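import Mathlib.Analysis.SpecialFunctions.Log.Deriv
import Mathlib.Analysis.SpecialFunctions.Pow.Deriv
import Mathlib.Analysis.SpecialFunctions.Pow.Continuity
import Literature.Geometry.Riemannian.RicciFlowMetricLimit
import Literature.Geometry.Lorentzian.MetricNormSqBounds
import Literature.Geometry.Riemannian.RicciFlowChartMetricBounds
import Literature.Geometry.Riemannian.CurvatureDerivativeNormSq
import Literature.Geometry.Riemannian.RicciFlowChartRmCovariantNorms
import Literature.Geometry.Riemannian.RicciFlowScaledChartCauchy
import Literature.Geometry.Riemannian.RicciFlowSmoothExtension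
import Literature.Analysis.Calculus.ContDiffUniformLimit
import Literature.Geometry.Riemannian.EinsteinWeylZero
import Literature.Geometry.Lorentzian.CoordCurvatureContinuity
import Literature.Geometry.Riemannian.CurvatureNormSq
import Literature.Geometry.Riemannian.RicciFlowScaling
import Literature.Geometry.Riemannian.MetricTraceScaling
import Literature.Geometry.Riemannian.RicciFlowBlowupLimit
import Literature.Geometry.Riemannian.HamiltonConvergenceCriterion
import Literature.Geometry.Riemannian.PinchingEstimatesConstraints
import Literature.Geometry.Riemannian.ChernGaussBonnetFourProofs
import Literature.Geometry.Riemannian.HamiltonPinchedFlowCurvatureDecay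
import HarnessLib

/-!
# Hamilton's pinched Ricci flow in dimension four, IV: the smooth round limit of `g(t)/(T − t)` — `hamilton_convergenceCriterion_four` HOLDS (re-homed proofs)

**Hamilton's convergence criterion (Hamilton 1986, §5, 5.2 "Convergence criterion", J. Differential Geom. 24, p. 164) in
dimension four — file 4 of 4, carrying the EXACT discharge `Literature.Geometry.Riemannian.hamilton_convergenceCriterion_four_holds :
hamilton_convergenceCriterion_four`** (the named fact of `HamiltonConvergenceCriterion.lean`, vended form: if along every Ricci flow
from `g₀` the curvature blocks stay in `{m ≤ tr A + tr C} ∩ {|M̊|² ≤ K (tr A + tr C)^{2−τ}}`, then `M` carries a `C^∞` Riemannian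
metric of constant sectional curvature `k > 0`) [Hamilton1986].  Contents: scaled metric equivalence and the continuous limit of
`g(t)/(T − t)` (Hamilton 1982, Lemma 14.2: a logarithmic Grönwall lemma); the scaled flow read in a chart (two-sided bounds,
Einstein defect, decay of the covariant Ricci derivatives, uniform `Cᵐ` bounds and the Cauchy property); the smooth limit metric
(Hamilton 1982, Cor. 17.10) and its roundness `Ric(g') = g'/2`, `W(g') = 0`, constant sectional curvature (Cor. 17.11; O'Neill 1983,
Lemma 3.38; Petersen 2006, Ch. 10 [Petersen2006]) [Hamilton1982]; the assembly `stub_smoothRoundLimit`; the passage from Hamilton's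
explicit pinching set to the tree's pinching sets; `constantCurvature_of_pinchedFlows_rails`; and
`hamilton_convergenceCriterion_four_holds` (EXACT name; in-tree original
`Summit.SmoothPoincare4.SmoothPoincare4.Theorems.MargerinRails.hamilton_convergenceCriterion_four_holds`, same proof).
RE-HOMED into `Literature/` by the Hodge foundations lane (`lit-hodgefound`, seat p20, generation 40): verbatim
DECLARATION-LEVEL ports (the declarations needed, in dependency order; each Part is one Summits module with a neutralised
module docstring) of the theorem-only cone below `Summits/SmoothPoincare4/SmoothPoincare4/Theorems/EntropyRungChangGurskyYangFlowLeafClosed.lean`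
(33 modules `EntropyRungMargerinRailsDefs`, `EntropyRungChangGurskyYang{StubInitialFit,StubMaximalFlow,StubInvariantPinching,
StubGradientEstimates*,StubRoundnessRate*,StubCurvatureRatio*,StubLimitRound,StubScaledShi,StubSmoothRoundLimit*,OfBlowupLimit,FlowLeafClosed}`;
139 declarations in four files `HamiltonPinchedFlowGradientEstimates` → `HamiltonPinchedFlowRoundnessRate` →
`HamiltonPinchedFlowCurvatureDecay` → `HamiltonConvergenceCriterionHolds`), namespace
`Summit.SmoothPoincare4.SmoothPoincare4.Theorems.MargerinRails` re-rooted as `Literature.Geometry.Riemannian.HamiltonPinchedFlow`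
(the in-tree `stub_…`/`helper_…` theorem names are kept so that twins have the same short names; they are proved theorems).
Built on the tree's Literature Ricci-flow layer (`Literature/Geometry/Riemannian/RicciFlow*`, `CurvatureNormSq`,
`CurvatureDerivativeNormSq`, `RicciFlowShiEstimates`, `ShiDerivativeMaxPrinciple`, `RicciFlowScalarMaximumPrinciple`,
`RicciFlowMaximal(Proofs)`, `RicciFlowShortTimeProofs`, `RicciFlowMetricLimit`, `RicciFlowSmoothExtension`, `HamiltonCurvatureODE`,
`HamiltonCurvatureRatio`, `PinchingEstimatesConstraints`, `ChangGurskyYang{Proofs,Regularity,WeylBudget}`, `BonnetMyers`, …) and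
`Literature/Geometry/Lorentzian/` (coordinate curvature calculus).  Imports Mathlib/Literature only; no new named fact (D-0026);
every declaration carries the citation of the printed statement it formalises or serves.  The Summits originals stay in place
(transitional duplication).  WHAT THIS IS NOT: nothing here bears on the smooth Poincaré conjecture in dimension four or on any
summit statement; it is Hamilton's 1982/1986 Ricci-flow analysis on a closed 4-manifold in the tree's vocabulary
(`PseudoRiemannianMetric`, `CovariantDerivative`, `IsRicciFlow` with explicit Levi-Civita witnesses).
-/

noncomputable section

/-!
## Part 1 — port of `Summits/SmoothPoincare4/SmoothPoincare4/Theorems/EntropyRungChangGurskyYangStubSmoothRoundLimitAux.lean` (3 declarations kept)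

# Scaled metric equivalence and the continuous limit of `g(t)/(T − t)` (Hamilton 1982, Lemma 14.2): a logarithmic Grönwall lemma and bilinear-form bounds

Declarations of this Part (verbatim port; each keeps its own docstring and citation): `logGronwall`, `normSq_toBilinForm_sub_smul`, `abs_sub_two_mul_apply_le`.

References: R. S. Hamilton, *Three-manifolds with positive Ricci curvature*, J. Differential Geom. 17 (1982) 255–306 [Hamilton1982]; R. S. Hamilton, *Four-manifolds with positive curvature operator*, J. Differential Geom. 24 (1986) 153–179 [Hamilton1986]; P. Topping, *Lectures on the Ricci flow*, LMS Lecture Note Series 325, CUP 2006 [Topping2006].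
-/

section Part1

open _root_.Set _root_.Function _root_.Filter _root_.Real _root_.Module
open scoped _root_.Manifold _root_.ContDiff _root_.Topology

namespace Literature.Geometry.Riemannian.HamiltonPinchedFlow

open Literature.Geometry.Riemannian
open Literature.Geometry.Lorentzian Literature.Geometry.Lorentzian.PseudoRiemannianMetric

/-! ### The logarithmic Grönwall lemma with an integrable rate -/

section Gronwall

/-- **Logarithmic Grönwall with the integrable rate `κ (T−t)^{δ−1}`.** Let `φ > 0` on `[t₀, T)`
have derivative `φ'` within `[t₀, T)` with `|(T−t) φ'(t) + φ(t)| ≤ κ (T−t)^δ φ(t)` (`δ > 0`),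
i.e. `ψ = φ/(T−t)` satisfies `|ψ'| ≤ κ (T−t)^{δ−1} ψ`. Then `log ψ ± (κ/δ)(T−t)^δ` are monotone,
so for `t ≤ t'` in `[t₀, T)`,
`e^{−(κ/δ)((T−t)^δ−(T−t')^δ)} ψ(t) ≤ ψ(t') ≤ e^{(κ/δ)((T−t)^δ−(T−t')^δ)} ψ(t)`, and `ψ` has a
positive limit `ℓ` as `t ↑ T` with `e^{−(κ/δ)(T−t)^δ} ψ(t) ≤ ℓ ≤ e^{(κ/δ)(T−t)^δ} ψ(t)`
(Hamilton 1982, Lemma 14.2: "if `∫ |∂ₜ g| dt < ∞` the metrics are uniformly equivalent and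
converge uniformly"). [cite: Hamilton1982, §14, Lemma 14.2] -/
theorem logGronwall {φ φ' : ℝ → ℝ} {t₀ T κ δ : ℝ} (hδ : 0 < δ) (ht₀ : t₀ < T)
    (hφ : ∀ t ∈ Ico t₀ T, HasDerivWithinAt φ (φ' t) (Ico t₀ T) t)
    (hpos : ∀ t ∈ Ico t₀ T, 0 < φ t)
    (hbd : ∀ t ∈ Ico t₀ T, |(T - t) * φ' t + φ t| ≤ κ * (T - t) ^ δ * φ t) :
    (∀ t ∈ Ico t₀ T, ∀ t' ∈ Ico t T,
      exp (-(κ / δ * ((T - t) ^ δ - (T - t') ^ δ))) * (φ t / (T - t)) ≤ φ t' / (T - t') ∧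
      φ t' / (T - t') ≤ exp (κ / δ * ((T - t) ^ δ - (T - t') ^ δ)) * (φ t / (T - t))) ∧
    ∃ ℓ : ℝ, 0 < ℓ ∧ Tendsto (fun t ↦ φ t / (T - t)) (𝓝[<] T) (𝓝 ℓ) ∧
      ∀ t ∈ Ico t₀ T, exp (-(κ / δ * (T - t) ^ δ)) * (φ t / (T - t)) ≤ ℓ ∧
        ℓ ≤ exp (κ / δ * (T - t) ^ δ) * (φ t / (T - t)) := by
  -- `κ ≥ 0` (test the bound at `t₀`)
  have hκ : 0 ≤ κ := by
    have h0 := hbd t₀ ⟨le_rfl, ht₀⟩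
    have h1 : 0 ≤ κ * (T - t₀) ^ δ * φ t₀ := (abs_nonneg _).trans h0
    have h2 : 0 < (T - t₀) ^ δ * φ t₀ := mul_pos (rpow_pos_of_pos (sub_pos.2 ht₀) δ) (hpos t₀ ⟨le_rfl, ht₀⟩)
    rw [mul_assoc] at h1
    exact nonneg_of_mul_nonneg_left h1 h2
  -- the functions
  set ψ : ℝ → ℝ := fun t ↦ φ t / (T - t) with hψ
  set F : ℝ → ℝ := fun t ↦ log (ψ t) with hF
  set h : ℝ → ℝ := fun t ↦ κ / δ * (T - t) ^ δ with hh
  have hψpos : ∀ t ∈ Ico t₀ T, 0 < ψ t := fun t ht ↦ div_pos (hpos t ht) (sub_pos.2 ht.2)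
  -- derivative of `ψ` and of `F`
  have hψder : ∀ t ∈ Ico t₀ T,
      HasDerivWithinAt ψ (((T - t) * φ' t + φ t) / (T - t) ^ 2) (Ico t₀ T) t := by
    intro t ht
    have hTt : T - t ≠ 0 := (sub_pos.2 ht.2).ne'
    have h1 : HasDerivWithinAt (fun s ↦ T - s) (-1) (Ico t₀ T) t := by
      simpa using (hasDerivWithinAt_id t (Ico t₀ T)).const_sub T
    have h2 := (hφ t ht).div h1 hTt
    refine h2.congr_deriv ?_
    field_simp
    ring
  have hFder : ∀ t ∈ Ico t₀ T,
      HasDerivWithinAt F (((T - t) * φ' t + φ t) / ((T - t) * φ t)) (Ico t₀ T) t := by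
    intro t ht
    have hTt : T - t ≠ 0 := (sub_pos.2 ht.2).ne'
    have hφt : φ t ≠ 0 := (hpos t ht).ne'
    have h2 := (hψder t ht).log (hψpos t ht).ne'
    refine h2.congr_deriv ?_
    simp only [hψ]
    field_simp
  have hFbd : ∀ t ∈ Ico t₀ T, |((T - t) * φ' t + φ t) / ((T - t) * φ t)| ≤ κ * (T - t) ^ (δ - 1) := by
    intro t ht
    have hTt : 0 < T - t := sub_pos.2 ht.2
    have hφt : 0 < φ t := hpos t ht
    rw [abs_div, abs_of_pos (mul_pos hTt hφt), div_le_iff₀ (mul_pos hTt hφt)]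
    calc |(T - t) * φ' t + φ t| ≤ κ * (T - t) ^ δ * φ t := hbd t ht
      _ = κ * (T - t) ^ (δ - 1) * ((T - t) * φ t) := by
          rw [show (T - t) ^ δ = (T - t) ^ (δ - 1) * (T - t) by
            rw [← rpow_add_one hTt.ne', sub_add_cancel]]
          ring
  -- derivative of `h`
  have hhder : ∀ t ∈ Ico t₀ T, HasDerivWithinAt h (-(κ * (T - t) ^ (δ - 1))) (Ico t₀ T) t := by
    intro t ht
    have hTt : T - t ≠ 0 := (sub_pos.2 ht.2).ne'
    have h1 : HasDerivWithinAt (fun s ↦ T - s) (-1) (Ico t₀ T) t := by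
      simpa using (hasDerivWithinAt_id t (Ico t₀ T)).const_sub T
    have h2 := (h1.rpow_const (p := δ) (Or.inl hTt)).const_mul (κ / δ)
    refine h2.congr_deriv ?_
    field_simp
  -- `F + h` is antitone, `F - h` is monotone on `[t₀, T)`
  have hcontF : ContinuousOn F (Ico t₀ T) := fun t ht ↦ (hFder t ht).continuousWithinAt
  have hconth : ContinuousOn h (Ico t₀ T) := fun t ht ↦ (hhder t ht).continuousWithinAt
  have hint : interior (Ico t₀ T) = Ioo t₀ T := interior_Ico
  have hanti : AntitoneOn (fun t ↦ F t + h t) (Ico t₀ T) := by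
    refine antitoneOn_of_hasDerivWithinAt_nonpos (convex_Ico t₀ T) (hcontF.add hconth)
      (f' := fun t ↦ ((T - t) * φ' t + φ t) / ((T - t) * φ t) + -(κ * (T - t) ^ (δ - 1))) ?_ ?_
    · intro t ht
      rw [hint] at ht ⊢
      exact ((hFder t (Ioo_subset_Ico_self ht)).add (hhder t (Ioo_subset_Ico_self ht))).mono
        Ioo_subset_Ico_self
    · intro t ht
      rw [hint] at ht
      have := hFbd t (Ioo_subset_Ico_self ht)
      linarith [le_abs_self (((T - t) * φ' t + φ t) / ((T - t) * φ t))]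
  have hmono : MonotoneOn (fun t ↦ F t - h t) (Ico t₀ T) := by
    refine monotoneOn_of_hasDerivWithinAt_nonneg (convex_Ico t₀ T) (hcontF.sub hconth)
      (f' := fun t ↦ ((T - t) * φ' t + φ t) / ((T - t) * φ t) - -(κ * (T - t) ^ (δ - 1))) ?_ ?_
    · intro t ht
      rw [hint] at ht ⊢
      exact ((hFder t (Ioo_subset_Ico_self ht)).sub (hhder t (Ioo_subset_Ico_self ht))).mono
        Ioo_subset_Ico_self
    · intro t ht
      rw [hint] at ht
      have := hFbd t (Ioo_subset_Ico_self ht)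
      linarith [neg_abs_le (((T - t) * φ' t + φ t) / ((T - t) * φ t))]
  -- two-sided comparison of `F`
  have hFcomp : ∀ t ∈ Ico t₀ T, ∀ t' ∈ Ico t T, |F t' - F t| ≤ h t - h t' := by
    intro t ht t' ht'
    have ht'' : t' ∈ Ico t₀ T := ⟨ht.1.trans ht'.1, ht'.2⟩
    have h1 := hanti ht ht'' ht'.1
    have h2 := hmono ht ht'' ht'.1
    simp only at h1 h2
    rw [abs_le]
    constructor <;> linarith
  have hψexp : ∀ t ∈ Ico t₀ T, ψ t = exp (F t) := fun t ht ↦ by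
    rw [hF, exp_log (hψpos t ht)]
  -- part (i)
  have part1 : ∀ t ∈ Ico t₀ T, ∀ t' ∈ Ico t T,
      exp (-(κ / δ * ((T - t) ^ δ - (T - t') ^ δ))) * ψ t ≤ ψ t' ∧
      ψ t' ≤ exp (κ / δ * ((T - t) ^ δ - (T - t') ^ δ)) * ψ t := by
    intro t ht t' ht'
    have ht'' : t' ∈ Ico t₀ T := ⟨ht.1.trans ht'.1, ht'.2⟩
    have hc := hFcomp t ht t' ht'
    have hdiff : h t - h t' = κ / δ * ((T - t) ^ δ - (T - t') ^ δ) := by simp only [hh]; ring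
    rw [hdiff, abs_le] at hc
    rw [hψexp t ht, hψexp t' ht'', ← exp_add, ← exp_add]
    constructor <;> apply exp_le_exp.2 <;> linarith
  refine ⟨part1, ?_⟩
  -- part (ii): the limit of `F - h`, of `h`, of `F`, of `ψ`
  have hT2 : (t₀ + T) / 2 ∈ Ioo t₀ T := by constructor <;> linarith
  have hbdd : BddAbove ((fun t ↦ F t - h t) '' Ioo t₀ T) := by
    refine ⟨F t₀ + h t₀, ?_⟩
    rintro _ ⟨t, ht, rfl⟩
    have hc := hFcomp t₀ ⟨le_rfl, ht₀⟩ t ⟨ht.1.le, ht.2⟩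
    rw [abs_le] at hc
    have hht : 0 ≤ h t := by
      simp only [hh]
      exact mul_nonneg (div_nonneg hκ hδ.le) (rpow_nonneg (sub_pos.2 ht.2).le δ)
    simp only
    linarith [hc.2]
  have hlim1 : Tendsto (fun t ↦ F t - h t) (𝓝[<] T)
      (𝓝 (sSup ((fun t ↦ F t - h t) '' Ioo t₀ T))) :=
    (hmono.mono Ioo_subset_Ico_self).tendsto_nhdsWithin_Ioo_left ⟨_, hT2⟩ hbdd
  have hlimh : Tendsto h (𝓝[<] T) (𝓝 0) := by
    have hc : ContinuousAt (fun t : ℝ ↦ κ / δ * (T - t) ^ δ) T :=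
      (ContinuousAt.rpow_const (f := fun t : ℝ ↦ T - t) (continuousAt_const.sub continuousAt_id)
        (Or.inr hδ.le)).const_mul _
    have h0 : h T = 0 := by simp [hh, sub_self, zero_rpow hδ.ne']
    rw [← h0]
    exact hc.tendsto.mono_left nhdsWithin_le_nhds
  set L : ℝ := sSup ((fun t ↦ F t - h t) '' Ioo t₀ T) with hL
  have hlimF : Tendsto F (𝓝[<] T) (𝓝 L) := by
    have := hlim1.add hlimh
    simpa using this
  have hlimψ : Tendsto ψ (𝓝[<] T) (𝓝 (exp L)) := by
    have h1 := (continuous_exp.tendsto L).comp hlimF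
    refine h1.congr' ?_
    filter_upwards [Ioo_mem_nhdsLT ht₀] with t ht
    exact (hψexp t (Ioo_subset_Ico_self ht)).symm
  refine ⟨exp L, exp_pos L, hlimψ, fun t ht ↦ ⟨?_, ?_⟩⟩
  · -- lower bound: pass to the limit `t' → T` in part (i)
    have hev : ∀ᶠ t' in 𝓝[<] T, t' ∈ Ico t T := Ico_mem_nhdsLT ht.2
    have hlimlow : Tendsto (fun t' ↦ exp (-(κ / δ * ((T - t) ^ δ - (T - t') ^ δ))) * ψ t)
        (𝓝[<] T) (𝓝 (exp (-(κ / δ * ((T - t) ^ δ - 0))) * ψ t)) := by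
      have hc : Tendsto (fun t' : ℝ ↦ (T - t') ^ δ) (𝓝[<] T) (𝓝 0) := by
        have hc' : ContinuousAt (fun t' : ℝ ↦ (T - t') ^ δ) T :=
          ContinuousAt.rpow_const (f := fun t' : ℝ ↦ T - t') (continuousAt_const.sub continuousAt_id)
            (Or.inr hδ.le)
        have h0 : (fun t' : ℝ ↦ (T - t') ^ δ) T = 0 := by simp [zero_rpow hδ.ne']
        rw [← h0]
        exact hc'.tendsto.mono_left nhdsWithin_le_nhds
      exact ((continuous_exp.tendsto _).comp
        ((tendsto_const_nhds.sub hc).const_mul (κ / δ)).neg).mul_const _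
    rw [sub_zero] at hlimlow
    exact le_of_tendsto_of_tendsto hlimlow hlimψ (hev.mono fun t' ht' ↦ (part1 t ht t' ht').1)
  · have hev : ∀ᶠ t' in 𝓝[<] T, t' ∈ Ico t T := Ico_mem_nhdsLT ht.2
    have hlimup : Tendsto (fun t' ↦ exp (κ / δ * ((T - t) ^ δ - (T - t') ^ δ)) * ψ t)
        (𝓝[<] T) (𝓝 (exp (κ / δ * ((T - t) ^ δ - 0)) * ψ t)) := by
      have hc : Tendsto (fun t' : ℝ ↦ (T - t') ^ δ) (𝓝[<] T) (𝓝 0) := by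
        have hc' : ContinuousAt (fun t' : ℝ ↦ (T - t') ^ δ) T :=
          ContinuousAt.rpow_const (f := fun t' : ℝ ↦ T - t') (continuousAt_const.sub continuousAt_id)
            (Or.inr hδ.le)
        have h0 : (fun t' : ℝ ↦ (T - t') ^ δ) T = 0 := by simp [zero_rpow hδ.ne']
        rw [← h0]
        exact hc'.tendsto.mono_left nhdsWithin_le_nhds
      exact ((continuous_exp.tendsto _).comp
        ((tendsto_const_nhds.sub hc).const_mul (κ / δ))).mul_const _
    rw [sub_zero] at hlimup
    exact le_of_tendsto_of_tendsto hlimψ hlimup (hev.mono fun t' ht' ↦ (part1 t ht t' ht').2)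

end Gronwall

/-! ### The velocity of the scaled metric: `|g − 2(T−t)Ric|²_g = ((T−t)R − 2)² + 4(T−t)²|E|²` -/

section Algebra

variable {E : Type*} [NormedAddCommGroup E] [NormedSpace ℝ E] [FiniteDimensional ℝ E]
  {H : Type*} [TopologicalSpace H] {I : ModelWithCorners ℝ E H}
  {M : Type*} [TopologicalSpace M] [ChartedSpace H M] [IsManifold I ∞ M] {n : ℕ∞ω}
  (g : PseudoRiemannianMetric I n E (TangentSpace I : M → Type _))

/-- **`|g − cT|²_g = m − 2c tr_g T + c² |T|²_g`** for a Riemannian metric on an `m`-dimensional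
model and a bilinear form `T` (expand in a `g_x`-orthonormal basis: `normSq_eq_sum_sq`,
`trace_eq_sum_of_isOrthonormalFrame`). [cite: ONeill1983, Ch. 3, pp. 60–61] -/
theorem normSq_toBilinForm_sub_smul (hg : g.IsRiemannian) {m : ℕ} (hE : finrank ℝ E = m) (x : M)
    (T : LinearMap.BilinForm ℝ (TangentSpace I x)) (c : ℝ) :
    g.normSq x (g.toBilinForm x - c • T) = m - 2 * c * g.trace x T + c ^ 2 * g.normSq x T := by
  classical
  obtain ⟨b, hb⟩ := g.exists_basis_isOrthonormalFrame (x := x) (fun v hv ↦ hg x v hv) hE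
  have hO : (g.toBilinForm x).IsOrthoᵢ b := fun i j hij ↦ hb.2 i j hij
  have hc : ∀ i, g.val x (b i) (b i) ≠ 0 := fun i ↦ by rw [hb.1 i]; exact one_ne_zero
  have hval : ∀ i j, g.val x (b j) (b i) = if j = i then 1 else 0 := fun i j ↦ by
    by_cases h : j = i
    · subst h; simp [hb.1 j]
    · simp [h, hb.2 j i h]
  rw [g.normSq_eq_sum_sq x b hO hc, g.normSq_eq_sum_sq x b hO hc,
    g.trace_eq_sum_of_isOrthonormalFrame b hb T]
  simp only [hb.1, mul_one, div_one, LinearMap.sub_apply, LinearMap.smul_apply, smul_eq_mul,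
    toBilinForm_apply, hval]
  have h1 : ∀ i, ∑ j, ((if j = i then (1 : ℝ) else 0) - c * T (b j) (b i)) ^ 2 =
      1 - 2 * c * T (b i) (b i) + c ^ 2 * ∑ j, T (b j) (b i) ^ 2 := by
    intro i
    have h2 : ∀ j, ((if j = i then (1 : ℝ) else 0) - c * T (b j) (b i)) ^ 2 =
        (if j = i then (1 : ℝ) else 0) - 2 * c * (if j = i then T (b j) (b i) else 0) +
          c ^ 2 * T (b j) (b i) ^ 2 := by
      intro j; split_ifs <;> ring
    simp only [h2, Finset.sum_add_distrib, Finset.sum_sub_distrib, Finset.sum_ite_eq',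
      Finset.mem_univ, if_true, ← Finset.mul_sum]
  simp only [h1, Finset.sum_add_distrib, Finset.sum_sub_distrib, ← Finset.mul_sum,
    Finset.sum_const, Finset.card_univ, Fintype.card_fin, nsmul_eq_mul, mul_one]

/-- **The pointwise velocity bound of the scaled metric** (Hamilton 1982, §17, Thm. 17.6 in
unnormalised form): on a `4`-dimensional model, if `|s tr T − 2| ≤ a₁` and
`s² (|T|² − (tr T)²/4) ≤ a₂` then `|g − 2sT|²_g = (s tr T − 2)² + 4 s² (|T|² − (tr T)²/4) ≤ a₁² + 4a₂`
and hence `|g(X,X) − 2s T(X,X)| ≤ (a₁² + 4a₂)^{1/2} g(X,X)` (Cauchy–Schwarz,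
`abs_apply_le_sqrt_normSq_mul`). [cite: Hamilton1982, §17, Thm. 17.6] -/
theorem abs_sub_two_mul_apply_le (hg : g.IsRiemannian) (hE : finrank ℝ E = 4) (x : M)
    (T : LinearMap.BilinForm ℝ (TangentSpace I x)) {s a₁ a₂ : ℝ}
    (h₁ : |s * g.trace x T - 2| ≤ a₁) (h₂ : s ^ 2 * (g.normSq x T - g.trace x T ^ 2 / 4) ≤ a₂)
    (X : TangentSpace I x) :
    |g.val x X X - 2 * s * T X X| ≤ Real.sqrt (a₁ ^ 2 + 4 * a₂) * g.val x X X := by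
  have hid := normSq_toBilinForm_sub_smul g hg hE x T (2 * s)
  have hle : g.normSq x (g.toBilinForm x - (2 * s) • T) ≤ a₁ ^ 2 + 4 * a₂ := by
    rw [hid]
    have ha₁ : (s * g.trace x T - 2) ^ 2 ≤ a₁ ^ 2 := by
      have h0 : 0 ≤ a₁ := (abs_nonneg _).trans h₁
      nlinarith [abs_nonneg (s * g.trace x T - 2), sq_abs (s * g.trace x T - 2)]
    push_cast
    nlinarith
  have hcs := g.abs_apply_le_sqrt_normSq_mul x hg (g.toBilinForm x - (2 * s) • T) X
  have happ : (g.toBilinForm x - (2 * s) • T) X X = g.val x X X - 2 * s * T X X := by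
    simp [smul_eq_mul]
  rw [happ] at hcs
  have hg0 : 0 ≤ g.val x X X := by
    by_cases hX : X = 0
    · subst hX; simp
    · exact (hg x X hX).le
  exact hcs.trans (mul_le_mul_of_nonneg_right (Real.sqrt_le_sqrt hle) hg0)

end Algebra

end Literature.Geometry.Riemannian.HamiltonPinchedFlow

end Part1

/-!
## Part 2 — port of `Summits/SmoothPoincare4/SmoothPoincare4/Theorems/EntropyRungChangGurskyYangStubSmoothRoundLimitAux2.lean` (1 declarations kept)

# The continuous limit of the scaled metrics `g(t)/(T − t)` (Hamilton 1982, Lemma 14.2)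

Declarations of this Part (verbatim port; each keeps its own docstring and citation): `scaledMetric_tendsto_diag`.

References: R. S. Hamilton, *Three-manifolds with positive Ricci curvature*, J. Differential Geom. 17 (1982) 255–306 [Hamilton1982]; A. L. Besse, *Einstein Manifolds*, Springer 1987 [Besse1987].
-/

section Part2

open _root_.Set _root_.Function _root_.Filter _root_.Real _root_.Module
open scoped _root_.Manifold _root_.ContDiff _root_.Topology

namespace Literature.Geometry.Riemannian.HamiltonPinchedFlow

open Literature.Geometry.Riemannian
open Literature.Geometry.Lorentzian Literature.Geometry.Lorentzian.PseudoRiemannianMetric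

section ScaledLimit

variable {M : Type*} [TopologicalSpace M] [ChartedSpace (EuclideanSpace ℝ (Fin 4)) M]
  [IsManifold (𝓡 4) ∞ M]
  {g : ℝ → PseudoRiemannianMetric (𝓡 4) ∞ (EuclideanSpace ℝ (Fin 4)) (TangentSpace (𝓡 4) : M → Type _)}
  {cov : ℝ → CovariantDerivative (𝓡 4) (EuclideanSpace ℝ (Fin 4)) (TangentSpace (𝓡 4) : M → Type _)}
  {T δ C t₀ : ℝ}

/-- **The diagonal case of Hamilton's Lemma 14.2 for the scaled metric**: along a Ricci flow of
Riemannian metrics on `[0, T)` with the two roundness rates on `[t₀, T)`, for every tangent vector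
`X ≠ 0` the function `t ↦ g_t(X,X)/(T−t)` obeys the two-sided logarithmic Grönwall control with
rate `κ (T−t)^{δ−1}`, `κ = (C² + 4C)^{1/2}`, and has a positive limit as `t ↑ T` within the
two-sided envelope. [cite: Hamilton1982, §14, Lemma 14.2] [cite: Hamilton1982, §17, Thm. 17.6] -/
theorem scaledMetric_tendsto_diag (hflow : IsRicciFlow g cov (Ico 0 T))
    (hR : ∀ t ∈ Ico 0 T, (g t).IsRiemannian) (hδ : 0 < δ) (ht₀ : t₀ ∈ Ico 0 T)
    (hrate : ∀ t ∈ Ico t₀ T, ∀ x : M,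
      |(T - t) * (g t).scalarCurvatureWith (cov t) x - 2| ≤ C * (T - t) ^ δ ∧
      (T - t) ^ 2 * ((g t).normSq x ((cov t).ricci x) -
        (g t).scalarCurvatureWith (cov t) x ^ 2 / 4) ≤ C * (T - t) ^ (2 * δ))
    (x : M) {X : TangentSpace (𝓡 4) x} (hX : X ≠ 0) :
    ∃ ℓ : ℝ, 0 < ℓ ∧ Tendsto (fun t ↦ (g t).val x X X / (T - t)) (𝓝[<] T) (𝓝 ℓ) ∧
      ∀ t ∈ Ico t₀ T,
        exp (-(Real.sqrt (C ^ 2 + 4 * C) / δ * (T - t) ^ δ)) * ((g t).val x X X / (T - t)) ≤ ℓ ∧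
        ℓ ≤ exp (Real.sqrt (C ^ 2 + 4 * C) / δ * (T - t) ^ δ) * ((g t).val x X X / (T - t)) := by
  have hsub : Ico t₀ T ⊆ Ico 0 T := fun t ht ↦ ⟨ht₀.1.trans ht.1, ht.2⟩
  have h4 : finrank ℝ (EuclideanSpace ℝ (Fin 4)) = 4 := finrank_euclideanSpace_fin
  -- `C ≥ 0` (test the first rate at `t₀`, `x`)
  have hC : 0 ≤ C := by
    have h1 := (hrate t₀ ⟨le_rfl, ht₀.2⟩ x).1
    have h2 : 0 < (T - t₀) ^ δ := rpow_pos_of_pos (sub_pos.2 ht₀.2) δ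
    exact nonneg_of_mul_nonneg_left ((abs_nonneg _).trans h1) h2
  -- the derivative bound `|(T−t)φ' + φ| ≤ κ (T−t)^δ φ`
  have hbd : ∀ t ∈ Ico t₀ T,
      |(T - t) * (-2 * (cov t).ricci x X X) + (g t).val x X X| ≤
        Real.sqrt (C ^ 2 + 4 * C) * (T - t) ^ δ * (g t).val x X X := by
    intro t ht
    have hTt : 0 < T - t := sub_pos.2 ht.2
    obtain ⟨h₁, h₂⟩ := hrate t ht x
    have key := abs_sub_two_mul_apply_le (g t) (hR t (hsub ht)) h4 x ((cov t).ricci x)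
      (s := T - t) h₁ h₂ X
    have hsqrt : Real.sqrt ((C * (T - t) ^ δ) ^ 2 + 4 * (C * (T - t) ^ (2 * δ))) =
        Real.sqrt (C ^ 2 + 4 * C) * (T - t) ^ δ := by
      have h2δ : (T - t) ^ (2 * δ) = ((T - t) ^ δ) ^ 2 := by
        rw [mul_comm, rpow_mul hTt.le, rpow_two]
      rw [h2δ, show (C * (T - t) ^ δ) ^ 2 + 4 * (C * ((T - t) ^ δ) ^ 2) =
        (C ^ 2 + 4 * C) * ((T - t) ^ δ) ^ 2 by ring, Real.sqrt_mul (by positivity),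
        Real.sqrt_sq (rpow_nonneg hTt.le δ)]
    rw [hsqrt] at key
    have hrw : (T - t) * (-2 * (cov t).ricci x X X) + (g t).val x X X =
        (g t).val x X X - 2 * (T - t) * (cov t).ricci x X X := by ring
    rw [hrw]
    exact key
  exact (logGronwall (φ := fun t ↦ (g t).val x X X) (φ' := fun t ↦ -2 * (cov t).ricci x X X)
    hδ ht₀.2 (fun t ht ↦ (hflow.hasDerivWithinAt t (hsub ht) x X X).mono hsub)
    (fun t ht ↦ hR t (hsub ht) x X hX) hbd).2

end ScaledLimit

end Literature.Geometry.Riemannian.HamiltonPinchedFlow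

end Part2

/-!
## Part 3 — port of `Summits/SmoothPoincare4/SmoothPoincare4/Theorems/EntropyRungChangGurskyYangStubSmoothRoundLimitChartDataAux.lean` (4 declarations kept)

# The scaled Ricci flow read in a chart, I: two-sided bounds and the Einstein defect (Hamilton 1982, Lemma 14.2 and Thm. 17.6)

Declarations of this Part (verbatim port; each keeps its own docstring and citation): `scaledMetric_comparison`, `scaledChartRep_comparison`, `scaledChartRep_twoSided`, `norm_ricAt_sub_smul_chartRep_le`.

References: R. S. Hamilton, *Three-manifolds with positive Ricci curvature*, J. Differential Geom. 17 (1982) 255–306 [Hamilton1982]; P. Topping, *Lectures on the Ricci flow*, LMS Lecture Note Series 325, CUP 2006 [Topping2006].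
-/

section Part3

-- operator spaces of bilinear forms over the model space
set_option maxSynthPendingDepth 3

open _root_.Set _root_.Function _root_.Filter _root_.Real _root_.Module _root_.Metric
open scoped _root_.Manifold _root_.ContDiff _root_.Topology

namespace Literature.Geometry.Riemannian.HamiltonPinchedFlow

open Literature.Geometry.Riemannian
open Literature.Geometry.Lorentzian Literature.Geometry.Lorentzian.PseudoRiemannianMetric
open Literature.Geometry.Lorentzian.MetricCoord

section ChartData

variable {M : Type*} [TopologicalSpace M] [ChartedSpace (EuclideanSpace ℝ (Fin 4)) M]
  [IsManifold (𝓡 4) ∞ M]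
  {g : ℝ → PseudoRiemannianMetric (𝓡 4) ∞ (EuclideanSpace ℝ (Fin 4)) (TangentSpace (𝓡 4) : M → Type _)}
  {cov : ℝ → CovariantDerivative (𝓡 4) (EuclideanSpace ℝ (Fin 4)) (TangentSpace (𝓡 4) : M → Type _)}
  {T δ C t₀ : ℝ}

/-! ### The two-sided comparison of the scaled metric with a fixed slice -/

/-- **Hamilton's Lemma 14.2 for the scaled metric, two-sided form**: along a Ricci flow of
Riemannian metrics on `[0, T)` with the two roundness rates on `[t₀, T)`, for every tangent vector
`X` and `t ∈ [t₀, T)`,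
`e^{−2a} g_{t₀}(X,X)/(T−t₀) ≤ g_t(X,X)/(T−t) ≤ e^{2a} g_{t₀}(X,X)/(T−t₀)` with
`a = (κ/δ)(T−t₀)^δ`, `κ = (C² + 4C)^{1/2}` (both slices lie in the logarithmic Grönwall envelope
of the limit, `scaledMetric_tendsto_diag`). [cite: Hamilton1982, §14, Lemma 14.2]
[cite: Hamilton1982, §17, Thm. 17.6] -/
theorem scaledMetric_comparison (hflow : IsRicciFlow g cov (Ico 0 T))
    (hR : ∀ t ∈ Ico 0 T, (g t).IsRiemannian) (hδ : 0 < δ) (ht₀ : t₀ ∈ Ico 0 T)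
    (hrate : ∀ t ∈ Ico t₀ T, ∀ x : M,
      |(T - t) * (g t).scalarCurvatureWith (cov t) x - 2| ≤ C * (T - t) ^ δ ∧
      (T - t) ^ 2 * ((g t).normSq x ((cov t).ricci x) -
        (g t).scalarCurvatureWith (cov t) x ^ 2 / 4) ≤ C * (T - t) ^ (2 * δ))
    (x : M) (X : TangentSpace (𝓡 4) x) {t : ℝ} (ht : t ∈ Ico t₀ T) :
    exp (-(2 * (Real.sqrt (C ^ 2 + 4 * C) / δ * (T - t₀) ^ δ))) *
        ((g t₀).val x X X / (T - t₀)) ≤ (g t).val x X X / (T - t) ∧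
      (g t).val x X X / (T - t) ≤
        exp (2 * (Real.sqrt (C ^ 2 + 4 * C) / δ * (T - t₀) ^ δ)) * ((g t₀).val x X X / (T - t₀)) := by
  have ht₀' : t₀ ∈ Ico t₀ T := ⟨le_rfl, ht₀.2⟩
  by_cases hX : X = 0
  · subst hX
    simp
  obtain ⟨ℓ, -, -, hbd⟩ := scaledMetric_tendsto_diag hflow hR hδ ht₀ hrate x hX
  obtain ⟨h0lo, h0up⟩ := hbd t₀ ht₀'
  obtain ⟨h1lo, h1up⟩ := hbd t ht
  set K : ℝ := Real.sqrt (C ^ 2 + 4 * C) / δ with hK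
  have hK0 : 0 ≤ K := div_nonneg (Real.sqrt_nonneg _) hδ.le
  have hTt : 0 < T - t := sub_pos.2 ht.2
  have hT₀ : 0 < T - t₀ := sub_pos.2 ht₀.2
  -- the envelope widths `A = K (T−t)^δ ≤ A₀ = K (T−t₀)^δ`
  have hAle : K * (T - t) ^ δ ≤ K * (T - t₀) ^ δ :=
    mul_le_mul_of_nonneg_left (rpow_le_rpow hTt.le (by linarith [ht.1]) hδ.le) hK0
  have hψ₀nn : 0 ≤ (g t₀).val x X X / (T - t₀) := (div_pos (hR t₀ ht₀ x X hX) hT₀).le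
  have hℓnn : 0 ≤ ℓ := le_trans (mul_nonneg (exp_pos _).le hψ₀nn) h0lo
  -- `ψ(t)` against `ℓ`
  have hψup : (g t).val x X X / (T - t) ≤ exp (K * (T - t) ^ δ) * ℓ := by
    have hea := mul_le_mul_of_nonneg_left h1lo (exp_pos (K * (T - t) ^ δ)).le
    rwa [← mul_assoc, ← exp_add, add_neg_cancel, exp_zero, one_mul] at hea
  have hψlo : exp (-(K * (T - t) ^ δ)) * ℓ ≤ (g t).val x X X / (T - t) := by
    have hea := mul_le_mul_of_nonneg_left h1up (exp_pos (-(K * (T - t) ^ δ))).le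
    rwa [← mul_assoc, ← exp_add, neg_add_cancel, exp_zero, one_mul] at hea
  constructor
  · -- lower bound
    have h2 : exp (-(K * (T - t₀) ^ δ)) * ℓ ≤ exp (-(K * (T - t) ^ δ)) * ℓ :=
      mul_le_mul_of_nonneg_right (exp_le_exp.2 (neg_le_neg hAle)) hℓnn
    have h3 : exp (-(K * (T - t₀) ^ δ)) * (exp (-(K * (T - t₀) ^ δ)) * ((g t₀).val x X X / (T - t₀)))
        ≤ exp (-(K * (T - t₀) ^ δ)) * ℓ := mul_le_mul_of_nonneg_left h0lo (exp_pos _).le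
    have h4 : exp (-(2 * (K * (T - t₀) ^ δ))) * ((g t₀).val x X X / (T - t₀)) =
        exp (-(K * (T - t₀) ^ δ)) * (exp (-(K * (T - t₀) ^ δ)) * ((g t₀).val x X X / (T - t₀))) := by
      rw [show -(2 * (K * (T - t₀) ^ δ)) = -(K * (T - t₀) ^ δ) + -(K * (T - t₀) ^ δ) by ring, exp_add]
      ring
    exact h4.le.trans (h3.trans (h2.trans hψlo))
  · -- upper bound
    have h2 : exp (K * (T - t) ^ δ) * ℓ ≤ exp (K * (T - t₀) ^ δ) * ℓ :=
      mul_le_mul_of_nonneg_right (exp_le_exp.2 hAle) hℓnn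
    have h3 : exp (K * (T - t₀) ^ δ) * ℓ ≤
        exp (K * (T - t₀) ^ δ) * (exp (K * (T - t₀) ^ δ) * ((g t₀).val x X X / (T - t₀))) :=
      mul_le_mul_of_nonneg_left h0up (exp_pos _).le
    have h4 : exp (K * (T - t₀) ^ δ) * (exp (K * (T - t₀) ^ δ) * ((g t₀).val x X X / (T - t₀))) =
        exp (2 * (K * (T - t₀) ^ δ)) * ((g t₀).val x X X / (T - t₀)) := by
      rw [show 2 * (K * (T - t₀) ^ δ) = K * (T - t₀) ^ δ + K * (T - t₀) ^ δ by ring, exp_add]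
      ring
    exact hψup.trans (h2.trans (h3.trans h4.le))

/-- **The two-sided comparison read in a chart**: for `y` in the chart target at `z` and a model
vector `v`, the scaled diagonal entry `G_t(y)(v,v)/(T−t)` of the chart representative is pinched
between `e^{∓2a} G_{t₀}(y)(v,v)/(T−t₀)` on `[t₀, T)` (`scaledMetric_comparison` on the frame
vector `X_v` at `Φ y`). [cite: Hamilton1982, §14, Lemma 14.2] [cite: Topping2006, Lemma 5.3.2] -/
theorem scaledChartRep_comparison (hflow : IsRicciFlow g cov (Ico 0 T))
    (hR : ∀ t ∈ Ico 0 T, (g t).IsRiemannian) (hδ : 0 < δ) (ht₀ : t₀ ∈ Ico 0 T)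
    (hrate : ∀ t ∈ Ico t₀ T, ∀ x : M,
      |(T - t) * (g t).scalarCurvatureWith (cov t) x - 2| ≤ C * (T - t) ^ δ ∧
      (T - t) ^ 2 * ((g t).normSq x ((cov t).ricci x) -
        (g t).scalarCurvatureWith (cov t) x ^ 2 / 4) ≤ C * (T - t) ^ (2 * δ))
    (z : M) (y v : EuclideanSpace ℝ (Fin 4)) {t : ℝ} (ht : t ∈ Ico t₀ T) :
    exp (-(2 * (Real.sqrt (C ^ 2 + 4 * C) / δ * (T - t₀) ^ δ))) *
        (chartRep (𝓡 4) g z t₀ y v v / (T - t₀)) ≤ chartRep (𝓡 4) g z t y v v / (T - t) ∧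
      chartRep (𝓡 4) g z t y v v / (T - t) ≤
        exp (2 * (Real.sqrt (C ^ 2 + 4 * C) / δ * (T - t₀) ^ δ)) *
          (chartRep (𝓡 4) g z t₀ y v v / (T - t₀)) :=
  scaledMetric_comparison hflow hR hδ ht₀ hrate ((extChartAt (𝓡 4) z).symm y)
    ((trivializationAt (EuclideanSpace ℝ (Fin 4)) (TangentSpace (𝓡 4) : M → Type _) z).symmL ℝ
      ((extChartAt (𝓡 4) z).symm y) v) ht

/-! ### Two-sided bounds of the scaled representative on a closed chart ball -/

/-- **The scaled chart representative is uniformly positive definite and bounded** (Topping 2006,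
Lemma 5.3.2 with the integrable rate of Hamilton 1982, Lemma 14.2): along a Ricci flow of
Riemannian metrics on `[0, T)` with the two roundness rates on `[t₀, T)`, on a closed ball
`B̄(ẑ, r) ⊆ target` of the chart at `z` there are `λ > 0` and `Λ` with
`λ|v|² ≤ G_t(y)(v,v)/(T−t)` and `‖G_t(y)/(T−t)‖ ≤ Λ` for all `y ∈ B̄(ẑ, r)`, `t ∈ [t₀, T)`
(`scaledChartRep_comparison`, uniform positivity and boundedness of the continuous `G_{t₀}` on
the compact ball, and polarisation `norm_le_of_quadratic_le`). [cite: Topping2006, Lemma 5.3.2]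
[cite: Hamilton1982, §14, Lemma 14.2] [cite: Topping2006, §5.3, p. 47] -/
theorem scaledChartRep_twoSided (hflow : IsRicciFlow g cov (Ico 0 T))
    (hR : ∀ t ∈ Ico 0 T, (g t).IsRiemannian) (hδ : 0 < δ) (ht₀ : t₀ ∈ Ico 0 T)
    (hrate : ∀ t ∈ Ico t₀ T, ∀ x : M,
      |(T - t) * (g t).scalarCurvatureWith (cov t) x - 2| ≤ C * (T - t) ^ δ ∧
      (T - t) ^ 2 * ((g t).normSq x ((cov t).ricci x) -
        (g t).scalarCurvatureWith (cov t) x ^ 2 / 4) ≤ C * (T - t) ^ (2 * δ))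
    (z : M) {r : ℝ} (hr : 0 ≤ r)
    (hcl : closedBall (extChartAt (𝓡 4) z z) r ⊆ (extChartAt (𝓡 4) z).target) :
    ∃ lam Λ : ℝ, 0 < lam ∧ ∀ t ∈ Ico t₀ T, ∀ y ∈ closedBall (extChartAt (𝓡 4) z z) r,
      (∀ v : EuclideanSpace ℝ (Fin 4), lam * ‖v‖ ^ 2 ≤ (T - t)⁻¹ * chartRep (𝓡 4) g z t y v v) ∧
      ‖(T - t)⁻¹ • chartRep (𝓡 4) g z t y‖ ≤ Λ := by
  have hT₀ : 0 < T - t₀ := sub_pos.2 ht₀.2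
  -- `G_{t₀}` on the compact ball
  have hG0 : ContinuousOn (chartRep (𝓡 4) g z t₀) (closedBall (extChartAt (𝓡 4) z z) r) := by
    have hsm : ContDiffOn ℝ ∞ (fun q : EuclideanSpace ℝ (Fin 4) × ℝ ↦ chartRep (𝓡 4) g z q.2 q.1)
        ((extChartAt (𝓡 4) z).target ×ˢ Ico 0 T) := contDiffOn_chartRep hflow.smooth z
    have hι : ContinuousOn (fun y : EuclideanSpace ℝ (Fin 4) ↦ ((y, t₀) : EuclideanSpace ℝ (Fin 4) × ℝ))
        (closedBall (extChartAt (𝓡 4) z z) r) :=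
      (continuous_id.prodMk continuous_const).continuousOn
    have hcomp := hsm.continuousOn.comp hι fun y hy ↦ ⟨hcl hy, ht₀⟩
    exact hcomp
  obtain ⟨lam₀, hlam₀, hlam₀le⟩ := exists_pos_le_quadratic_of_isCompact (isCompact_closedBall _ r)
    hG0 (fun y hy v hv ↦ chartRep_pos (hR t₀ ht₀) z ⟨y, hcl hy⟩ v hv)
  obtain ⟨M₀, hM₀⟩ := (isCompact_closedBall _ r).exists_bound_of_continuousOn hG0
  have hM₀nn : 0 ≤ M₀ := (norm_nonneg _).trans (hM₀ _ (mem_closedBall_self hr))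
  set A : ℝ := 2 * (Real.sqrt (C ^ 2 + 4 * C) / δ * (T - t₀) ^ δ) with hA
  refine ⟨exp (-A) * (lam₀ / (T - t₀)), 2 * (exp A * (M₀ / (T - t₀))),
    mul_pos (exp_pos _) (div_pos hlam₀ hT₀), fun t ht y hy ↦ ?_⟩
  have hTt : 0 < T - t := sub_pos.2 ht.2
  have hy' : y ∈ (extChartAt (𝓡 4) z).target := hcl hy
  -- the comparison with the slice `t₀`
  have hcomp : ∀ v : EuclideanSpace ℝ (Fin 4),
      exp (-A) * (lam₀ / (T - t₀)) * ‖v‖ ^ 2 ≤ chartRep (𝓡 4) g z t y v v / (T - t) ∧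
      chartRep (𝓡 4) g z t y v v / (T - t) ≤ exp A * (M₀ / (T - t₀)) * ‖v‖ ^ 2 := by
    intro v
    obtain ⟨hlo, hup⟩ := scaledChartRep_comparison hflow hR hδ ht₀ hrate z y v ht
    have hψ₀lo : lam₀ * ‖v‖ ^ 2 / (T - t₀) ≤ chartRep (𝓡 4) g z t₀ y v v / (T - t₀) :=
      div_le_div_of_nonneg_right (hlam₀le y hy v) hT₀.le
    have hψ₀up : chartRep (𝓡 4) g z t₀ y v v / (T - t₀) ≤ M₀ * ‖v‖ ^ 2 / (T - t₀) := by
      refine div_le_div_of_nonneg_right ?_ hT₀.le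
      have h1 := abs_apply₂_le (chartRep (𝓡 4) g z t₀ y) v v
      have h2 : ‖chartRep (𝓡 4) g z t₀ y‖ * ‖v‖ * ‖v‖ ≤ M₀ * ‖v‖ * ‖v‖ :=
        mul_le_mul_of_nonneg_right (mul_le_mul_of_nonneg_right (hM₀ y hy) (norm_nonneg _))
          (norm_nonneg _)
      calc chartRep (𝓡 4) g z t₀ y v v ≤ M₀ * ‖v‖ * ‖v‖ := (le_abs_self _).trans (h1.trans h2)
        _ = M₀ * ‖v‖ ^ 2 := by ring
    constructor
    · calc exp (-A) * (lam₀ / (T - t₀)) * ‖v‖ ^ 2 = exp (-A) * (lam₀ * ‖v‖ ^ 2 / (T - t₀)) := by ring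
        _ ≤ exp (-A) * (chartRep (𝓡 4) g z t₀ y v v / (T - t₀)) :=
            mul_le_mul_of_nonneg_left hψ₀lo (exp_pos _).le
        _ ≤ chartRep (𝓡 4) g z t y v v / (T - t) := hlo
    · calc chartRep (𝓡 4) g z t y v v / (T - t)
          ≤ exp A * (chartRep (𝓡 4) g z t₀ y v v / (T - t₀)) := hup
        _ ≤ exp A * (M₀ * ‖v‖ ^ 2 / (T - t₀)) := mul_le_mul_of_nonneg_left hψ₀up (exp_pos _).le
        _ = exp A * (M₀ / (T - t₀)) * ‖v‖ ^ 2 := by ring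
  have happ : ∀ v w : EuclideanSpace ℝ (Fin 4), ((T - t)⁻¹ • chartRep (𝓡 4) g z t y) v w =
      (T - t)⁻¹ * chartRep (𝓡 4) g z t y v w := fun v w ↦ by
    simp only [_root_.smul_apply, smul_eq_mul]
  refine ⟨fun v ↦ ?_, ?_⟩
  · rw [← div_eq_inv_mul]
    exact (hcomp v).1
  · have hsymm : ∀ v w, ((T - t)⁻¹ • chartRep (𝓡 4) g z t y) v w =
        ((T - t)⁻¹ • chartRep (𝓡 4) g z t y) w v := fun v w ↦ by
      rw [happ, happ, chartRep_symm z t hy' v w]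
    refine norm_le_of_quadratic_le hsymm (mul_nonneg (exp_pos _).le (div_nonneg hM₀nn hT₀.le))
      fun v ↦ ?_
    rw [happ, ← div_eq_inv_mul]
    have hnn : 0 ≤ chartRep (𝓡 4) g z t y v v / (T - t) :=
      le_trans (mul_nonneg (mul_nonneg (exp_pos _).le (div_nonneg hlam₀.le hT₀.le)) (sq_nonneg _))
        (hcomp v).1
    rw [abs_of_nonneg hnn]
    exact (hcomp v).2

/-! ### The Einstein defect of the scaled metric in the chart -/

/-- **The Einstein defect of the scaled metric decays in the chart** (Hamilton 1982, §17,
Thm. 17.6 read in a chart): along a Ricci flow of Riemannian metrics on `[0, T)` with the two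
roundness rates on `[t₀, T)`, at a point `y` of the chart target at `z` and a time `t ∈ [t₀, T)`
where `‖G_t(y)/(T−t)‖ ≤ Λ`, the form `Ric(G_t)(y) − G_t(y)/(2(T−t))` (the chart expression of
`Ric(g̃) − g̃/2`, `g̃ = g/(T−t)`, by the scale invariance of the Ricci tensor) has operator norm
`≤ (C² + 4C)^{1/2} Λ (T−t)^δ`: on the diagonal
`|G − 2(T−t)Ric(G)|(v,v) = |g − 2(T−t)Ric|(X_v,X_v) ≤ κ (T−t)^δ g(X_v,X_v) ≤ κ Λ (T−t)^{1+δ}|v|²`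
(`abs_sub_two_mul_apply_le`, `IsRicciFlow.ricAt_chartRep_eq_ricci`), then polarisation.
[cite: Hamilton1982, §17, Thm. 17.6] [cite: Topping2006, §5.3, p. 47] -/
theorem norm_ricAt_sub_smul_chartRep_le (hflow : IsRicciFlow g cov (Ico 0 T))
    (hR : ∀ t ∈ Ico 0 T, (g t).IsRiemannian) (ht₀ : t₀ ∈ Ico 0 T)
    (hrate : ∀ t ∈ Ico t₀ T, ∀ x : M,
      |(T - t) * (g t).scalarCurvatureWith (cov t) x - 2| ≤ C * (T - t) ^ δ ∧
      (T - t) ^ 2 * ((g t).normSq x ((cov t).ricci x) -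
        (g t).scalarCurvatureWith (cov t) x ^ 2 / 4) ≤ C * (T - t) ^ (2 * δ))
    (z : M) {y : EuclideanSpace ℝ (Fin 4)} (hy : y ∈ (extChartAt (𝓡 4) z).target) {t : ℝ}
    (ht : t ∈ Ico t₀ T) {Λ : ℝ} (hΛ : ‖(T - t)⁻¹ • chartRep (𝓡 4) g z t y‖ ≤ Λ) :
    ‖ricAt (chartRep (𝓡 4) g z t) y - (2 * (T - t))⁻¹ • chartRep (𝓡 4) g z t y‖ ≤
      Real.sqrt (C ^ 2 + 4 * C) * Λ * (T - t) ^ δ := by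
  have hTt : 0 < T - t := sub_pos.2 ht.2
  have h2ne : (2 * (T - t)) ≠ 0 := mul_ne_zero two_ne_zero hTt.ne'
  have h2pos : 0 < (2 * (T - t))⁻¹ := inv_pos.2 (mul_pos two_pos hTt)
  have hcanc : (2 * (T - t))⁻¹ * (T - t) = 2⁻¹ := by
    rw [mul_inv, mul_assoc, inv_mul_cancel₀ hTt.ne', mul_one]
  have ht' : t ∈ Ico 0 T := ⟨ht₀.1.trans ht.1, ht.2⟩
  have h4 : finrank ℝ (EuclideanSpace ℝ (Fin 4)) = 4 := finrank_euclideanSpace_fin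
  have hΛ0 : 0 ≤ Λ := (norm_nonneg _).trans hΛ
  have hGm : IsMetricOn (chartRep (𝓡 4) g z t) (extChartAt (𝓡 4) z).target := isMetricOn_chartRep g z t
  have happ : ∀ v w : EuclideanSpace ℝ (Fin 4), ((T - t)⁻¹ • chartRep (𝓡 4) g z t y) v w =
      (T - t)⁻¹ * chartRep (𝓡 4) g z t y v w := fun v w ↦ by
    simp only [_root_.smul_apply, smul_eq_mul]
  -- `G_t(y)(u,u) ≤ Λ (T−t) |u|²`
  have hup : ∀ u : EuclideanSpace ℝ (Fin 4), chartRep (𝓡 4) g z t y u u ≤ Λ * (T - t) * ‖u‖ ^ 2 := by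
    intro u
    have h1 := abs_apply₂_le ((T - t)⁻¹ • chartRep (𝓡 4) g z t y) u u
    rw [happ, abs_mul, abs_of_pos (inv_pos.2 hTt)] at h1
    have h3 : ‖(T - t)⁻¹ • chartRep (𝓡 4) g z t y‖ * ‖u‖ * ‖u‖ ≤ Λ * ‖u‖ * ‖u‖ :=
      mul_le_mul_of_nonneg_right (mul_le_mul_of_nonneg_right hΛ (norm_nonneg _)) (norm_nonneg _)
    have h5 : (T - t)⁻¹ * chartRep (𝓡 4) g z t y u u ≤ Λ * ‖u‖ ^ 2 := by
      calc (T - t)⁻¹ * chartRep (𝓡 4) g z t y u u ≤ (T - t)⁻¹ * |chartRep (𝓡 4) g z t y u u| :=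
            mul_le_mul_of_nonneg_left (le_abs_self _) (inv_pos.2 hTt).le
        _ ≤ Λ * ‖u‖ * ‖u‖ := h1.trans h3
        _ = Λ * ‖u‖ ^ 2 := by ring
    rw [inv_mul_le_iff₀ hTt] at h5
    calc chartRep (𝓡 4) g z t y u u ≤ (T - t) * (Λ * ‖u‖ ^ 2) := h5
      _ = Λ * (T - t) * ‖u‖ ^ 2 := by ring
  -- the diagonal bound of the defect
  have hdiag : ∀ u : EuclideanSpace ℝ (Fin 4),
      |(ricAt (chartRep (𝓡 4) g z t) y - (2 * (T - t))⁻¹ • chartRep (𝓡 4) g z t y) u u| ≤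
        Real.sqrt (C ^ 2 + 4 * C) * Λ / 2 * (T - t) ^ δ * ‖u‖ ^ 2 := by
    intro u
    set x : M := (extChartAt (𝓡 4) z).symm y with hx
    set X : TangentSpace (𝓡 4) x :=
      (trivializationAt (EuclideanSpace ℝ (Fin 4)) (TangentSpace (𝓡 4) : M → Type _) z).symmL ℝ x u
      with hX
    have hG : chartRep (𝓡 4) g z t y u u = (g t).val x X X := rfl
    have hRic : ricAt (chartRep (𝓡 4) g z t) y u u = (cov t).ricci x X X :=
      hflow.ricAt_chartRep_eq_ricci ht' z ⟨y, hy⟩ u u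
    obtain ⟨h₁, h₂⟩ := hrate t ht x
    have key := abs_sub_two_mul_apply_le (g t) (hR t ht') h4 x ((cov t).ricci x) (s := T - t) h₁ h₂ X
    have hsqrt : Real.sqrt ((C * (T - t) ^ δ) ^ 2 + 4 * (C * (T - t) ^ (2 * δ))) =
        Real.sqrt (C ^ 2 + 4 * C) * (T - t) ^ δ := by
      have h2δ : (T - t) ^ (2 * δ) = ((T - t) ^ δ) ^ 2 := by
        rw [mul_comm, rpow_mul hTt.le, rpow_two]
      rw [h2δ, show (C * (T - t) ^ δ) ^ 2 + 4 * (C * ((T - t) ^ δ) ^ 2) =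
        (C ^ 2 + 4 * C) * ((T - t) ^ δ) ^ 2 by ring, Real.sqrt_mul' _ (sq_nonneg _),
        Real.sqrt_sq (rpow_nonneg hTt.le δ)]
    rw [hsqrt] at key
    have hval : (ricAt (chartRep (𝓡 4) g z t) y - (2 * (T - t))⁻¹ • chartRep (𝓡 4) g z t y) u u =
        (2 * (T - t))⁻¹ * (2 * (T - t) * (cov t).ricci x X X - (g t).val x X X) := by
      simp only [_root_.sub_apply, _root_.smul_apply, smul_eq_mul]
      rw [hRic, hG, mul_sub (2 * (T - t))⁻¹, ← mul_assoc, inv_mul_cancel₀ h2ne, one_mul]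
    rw [hval, abs_mul, abs_of_pos h2pos, abs_sub_comm]
    have hg0 : 0 ≤ Real.sqrt (C ^ 2 + 4 * C) * (T - t) ^ δ :=
      mul_nonneg (Real.sqrt_nonneg _) (rpow_nonneg hTt.le δ)
    calc (2 * (T - t))⁻¹ * |(g t).val x X X - 2 * (T - t) * (cov t).ricci x X X|
        ≤ (2 * (T - t))⁻¹ * (Real.sqrt (C ^ 2 + 4 * C) * (T - t) ^ δ * (g t).val x X X) :=
          mul_le_mul_of_nonneg_left key h2pos.le
      _ ≤ (2 * (T - t))⁻¹ * (Real.sqrt (C ^ 2 + 4 * C) * (T - t) ^ δ * (Λ * (T - t) * ‖u‖ ^ 2)) :=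
          mul_le_mul_of_nonneg_left (mul_le_mul_of_nonneg_left (hG ▸ hup u) hg0) h2pos.le
      _ = (2 * (T - t))⁻¹ * (T - t) * (Real.sqrt (C ^ 2 + 4 * C) * Λ * (T - t) ^ δ * ‖u‖ ^ 2) := by
          ring
      _ = Real.sqrt (C ^ 2 + 4 * C) * Λ / 2 * (T - t) ^ δ * ‖u‖ ^ 2 := by
          rw [hcanc]
          ring
  -- polarisation
  have hsymm : ∀ v w, (ricAt (chartRep (𝓡 4) g z t) y - (2 * (T - t))⁻¹ • chartRep (𝓡 4) g z t y) v w =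
      (ricAt (chartRep (𝓡 4) g z t) y - (2 * (T - t))⁻¹ • chartRep (𝓡 4) g z t y) w v := by
    intro v w
    simp only [_root_.sub_apply, _root_.smul_apply, smul_eq_mul,
      hGm.ricAt_comm hy v w, chartRep_symm z t hy v w]
  have hc : 0 ≤ Real.sqrt (C ^ 2 + 4 * C) * Λ / 2 * (T - t) ^ δ :=
    mul_nonneg (div_nonneg (mul_nonneg (Real.sqrt_nonneg _) hΛ0) two_pos.le) (rpow_nonneg hTt.le δ)
  calc ‖ricAt (chartRep (𝓡 4) g z t) y - (2 * (T - t))⁻¹ • chartRep (𝓡 4) g z t y‖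
      ≤ 2 * (Real.sqrt (C ^ 2 + 4 * C) * Λ / 2 * (T - t) ^ δ) := norm_le_of_quadratic_le hsymm hc hdiag
    _ = Real.sqrt (C ^ 2 + 4 * C) * Λ * (T - t) ^ δ := by ring

end ChartData

/-! ### Main statement -/

end Literature.Geometry.Riemannian.HamiltonPinchedFlow

end Part3

/-!
## Part 4 — port of `Summits/SmoothPoincare4/SmoothPoincare4/Theorems/EntropyRungChangGurskyYangStubSmoothRoundLimitChartData.lean` (3 declarations kept)

# The scaled Ricci flow read in a chart, II: decay of the covariant Ricci derivatives (Topping 2006, Thm. 3.3.1, §5.3)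

Declarations of this Part (verbatim port; each keeps its own docstring and citation): `curvDerivNormSq_decay_from`, `abs_tcovIter_ric2_chartRep_le`, `helper_scaledChart_data`.

References: R. S. Hamilton, *Three-manifolds with positive Ricci curvature*, J. Differential Geom. 17 (1982) 255–306 [Hamilton1982]; P. Topping, *Lectures on the Ricci flow*, LMS Lecture Note Series 325, CUP 2006 [Topping2006].
-/

section Part4

-- operator spaces of bilinear forms over the model space
set_option maxSynthPendingDepth 3

open _root_.Set _root_.Function _root_.Filter _root_.Real _root_.Module _root_.Metric
open scoped _root_.Manifold _root_.ContDiff _root_.Topology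

namespace Literature.Geometry.Riemannian.HamiltonPinchedFlow

open Literature.Geometry.Riemannian
open Literature.Geometry.Lorentzian Literature.Geometry.Lorentzian.PseudoRiemannianMetric
open Literature.Geometry.Lorentzian.MetricCoord

section ChartData

variable {M : Type*} [TopologicalSpace M] [ChartedSpace (EuclideanSpace ℝ (Fin 4)) M]
  [IsManifold (𝓡 4) ∞ M]
  {g : ℝ → PseudoRiemannianMetric (𝓡 4) ∞ (EuclideanSpace ℝ (Fin 4)) (TangentSpace (𝓡 4) : M → Type _)}
  {cov : ℝ → CovariantDerivative (𝓡 4) (EuclideanSpace ℝ (Fin 4)) (TangentSpace (𝓡 4) : M → Type _)}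
  {T t₀ : ℝ}

/-! ### The decay of `|∇^{k+1}Rm|²` from `t₀` on -/

/-- **The decay of `|∇^{k+1}Rm|²` holds from `t₀` on**: if
`|∇^{k+1}Rm|²(t, ·) ≤ C' (T−t)^{δ'−k−3}` on `M × [t', T)` for some `t' < T`, then, with another
constant `C'' ≥ 0`, on `M × [t₀, T)`: the function `(x, t) ↦ |∇^{k+1}Rm|²(t, x)` is continuous on
the compact `M × [t₀, t']` (`IsRicciFlow.contMDiffOn_curvDerivNormSq`), where `(T−t)^{δ'−k−3}` has
a positive minimum. [cite: Topping2006, Thm. 3.3.1] [cite: Topping2006, §5.3, p. 47] -/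
theorem curvDerivNormSq_decay_from [CompactSpace M] (hflow : IsRicciFlow g cov (Ico 0 T))
    (hR : ∀ t ∈ Ico 0 T, (g t).IsRiemannian) (ht₀ : t₀ ∈ Ico 0 T) {k : ℕ} {δ' C' t' : ℝ}
    (ht' : t' ∈ Ico 0 T)
    (hdec : ∀ t ∈ Ico t' T, ∀ x : M,
      curvDerivNormSq (𝓡 4) g (k + 1) t x ≤ C' * (T - t) ^ (δ' - k - 3)) :
    ∃ C'' : ℝ, 0 ≤ C'' ∧ ∀ t ∈ Ico t₀ T, ∀ x : M,
      curvDerivNormSq (𝓡 4) g (k + 1) t x ≤ C'' * (T - t) ^ (δ' - k - 3) := by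
  have hT : 0 < T := ht₀.1.trans_lt ht₀.2
  rcases le_or_gt t' t₀ with hle | hle
  · refine ⟨max C' 0, le_max_right _ _, fun t ht x ↦ (hdec t ⟨hle.trans ht.1, ht.2⟩ x).trans ?_⟩
    exact mul_le_mul_of_nonneg_right (le_max_left _ _) (rpow_nonneg (sub_pos.2 ht.2).le _)
  -- continuity on `M × [t₀, t']`
  have hS : UniqueDiffOn ℝ (Ico 0 T) := uniqueDiffOn_Ico 0 T
  have hS' : Ico 0 T ⊆ closure (interior (Ico 0 T)) := by
    rw [interior_Ico, closure_Ioo hT.ne]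
    exact Ico_subset_Icc_self
  have hcont : ContinuousOn (fun p : M × ℝ ↦ curvDerivNormSq (𝓡 4) g (k + 1) p.2 p.1)
      (univ ×ˢ Icc t₀ t') :=
    ((hflow.contMDiffOn_curvDerivNormSq hS hS' hR (k + 1)).continuousOn).mono
      (prod_mono Subset.rfl fun t ht ↦ ⟨ht₀.1.trans ht.1, ht.2.trans_lt ht'.2⟩)
  obtain ⟨B, hB⟩ := (isCompact_univ.prod isCompact_Icc).exists_bound_of_continuousOn hcont
  -- a positive lower bound of `(T − t)^{δ'−k−3}` on `[t₀, t']`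
  have hpowcont : ContinuousOn (fun t : ℝ ↦ (T - t) ^ (δ' - k - 3)) (Icc t₀ t') :=
    ContinuousOn.rpow_const (continuousOn_const.sub continuousOn_id) fun t ht ↦
      Or.inl (sub_pos.2 (ht.2.trans_lt ht'.2)).ne'
  obtain ⟨s, hs, hmin⟩ := isCompact_Icc.exists_isMinOn (nonempty_Icc.2 hle.le) hpowcont
  have hm : 0 < (T - s) ^ (δ' - k - 3) := rpow_pos_of_pos (sub_pos.2 (hs.2.trans_lt ht'.2)) _
  refine ⟨max (max C' 0) (max B 0 / (T - s) ^ (δ' - k - 3)),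
    (le_max_right C' 0).trans (le_max_left _ _), fun t ht x ↦ ?_⟩
  have hTt : 0 < T - t := sub_pos.2 ht.2
  rcases le_or_gt t' t with htt' | htt'
  · calc curvDerivNormSq (𝓡 4) g (k + 1) t x ≤ C' * (T - t) ^ (δ' - k - 3) := hdec t ⟨htt', ht.2⟩ x
      _ ≤ _ := mul_le_mul_of_nonneg_right ((le_max_left C' 0).trans (le_max_left _ _))
          (rpow_nonneg hTt.le _)
  · have htI : t ∈ Icc t₀ t' := ⟨ht.1, htt'.le⟩
    have hb := hB (x, t) ⟨mem_univ _, htI⟩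
    rw [Real.norm_eq_abs] at hb
    have h1 : curvDerivNormSq (𝓡 4) g (k + 1) t x ≤ max B 0 :=
      (le_abs_self _).trans (hb.trans (le_max_left _ _))
    have h2 : (T - s) ^ (δ' - k - 3) ≤ (T - t) ^ (δ' - k - 3) := (isMinOn_iff.1 hmin) t htI
    calc curvDerivNormSq (𝓡 4) g (k + 1) t x ≤ max B 0 := h1
      _ = max B 0 / (T - s) ^ (δ' - k - 3) * (T - s) ^ (δ' - k - 3) := (div_mul_cancel₀ _ hm.ne').symm
      _ ≤ max B 0 / (T - s) ^ (δ' - k - 3) * (T - t) ^ (δ' - k - 3) :=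
          mul_le_mul_of_nonneg_left h2 (div_nonneg (le_max_right _ _) hm.le)
      _ ≤ _ := mul_le_mul_of_nonneg_right (le_max_right _ _) (rpow_nonneg hTt.le _)

/-! ### Components of `∇^{k+1}Ric` of the chart representative -/

/-- **The components of `∇^{k+1}Ric` of the chart representative decay like `(T−t)^{δ'/2}`**
(Topping 2006, p. 47, (5.3.3), with decay weights): if `|∇^{k+1}Rm|²(t, ·) ≤ C' (T−t)^{δ'−k−3}`
on `M × [t₀, T)` and `‖G_t(y)/(T−t)‖ ≤ Λ` at a point `y` of the chart target at `z` and a time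
`t ∈ [t₀, T)`, then every component of `∇^{k+1}Ric(G_t)` at `y` (basis `finBasis`) is at most
`(… )^{1/2} (T−t)^{δ'/2}`: `|∇^{k+1}Ric|²_g ≤ n|∇^{k+1}Rm|²_g = n · U_{k+1}(t, Φ y)`
(`IsMetricOn.tnormSq_tcovIter_ric2_le`, `curvDerivNormSq_eq_chart`, `curvD_eq_tcovIter`) and
`|T_J| ≤ (Π_a g_{J_aJ_a})^{1/2}|T|` with the `k + 3` factors `g_{ii} ≤ Λ (Σ|b_i|)² (T−t)`.
[cite: Topping2006, §5.3, p. 47] [cite: Topping2006, Thm. 3.3.1] -/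
theorem abs_tcovIter_ric2_chartRep_le (hR : ∀ t ∈ Ico 0 T, (g t).IsRiemannian)
    (ht₀ : t₀ ∈ Ico 0 T) {k : ℕ} {δ' C' : ℝ} (hC' : 0 ≤ C')
    (hdec : ∀ t ∈ Ico t₀ T, ∀ x : M,
      curvDerivNormSq (𝓡 4) g (k + 1) t x ≤ C' * (T - t) ^ (δ' - k - 3))
    (z : M) {y : EuclideanSpace ℝ (Fin 4)} (hy : y ∈ (extChartAt (𝓡 4) z).target) {t : ℝ}
    (ht : t ∈ Ico t₀ T) {Λ : ℝ} (hΛ : ‖(T - t)⁻¹ • chartRep (𝓡 4) g z t y‖ ≤ Λ)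
    (J : Fin (k + 1) ⊕ Fin 2 → Fin (finrank ℝ (EuclideanSpace ℝ (Fin 4)))) :
    |tcovIter (chartRep (𝓡 4) g z t) (finBasis ℝ (EuclideanSpace ℝ (Fin 4))) (k + 1)
        (ric2 (chartRep (𝓡 4) g z t) (finBasis ℝ (EuclideanSpace ℝ (Fin 4)))) y J| ≤
      Real.sqrt ((Λ * (∑ i, ‖finBasis ℝ (EuclideanSpace ℝ (Fin 4)) i‖) ^ 2) ^ (k + 3) *
        (Fintype.card (Fin (finrank ℝ (EuclideanSpace ℝ (Fin 4)))) * C')) * (T - t) ^ (δ' / 2) := by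
  classical
  set b := finBasis ℝ (EuclideanSpace ℝ (Fin 4)) with hb
  set β : ℝ := ∑ i, ‖b i‖ with hβ
  set G := chartRep (𝓡 4) g z t with hG
  have hβ0 : 0 ≤ β := Finset.sum_nonneg fun i _ ↦ norm_nonneg (b i)
  have hTt : 0 < T - t := sub_pos.2 ht.2
  have ht' : t ∈ Ico 0 T := ⟨ht₀.1.trans ht.1, ht.2⟩
  have hΛ0 : 0 ≤ Λ := (norm_nonneg _).trans hΛ
  have hGm : IsMetricOn G (extChartAt (𝓡 4) z).target := isMetricOn_chartRep g z t
  have hsy := hGm.symm y hy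
  have hposy : ∀ v, v ≠ 0 → 0 < G y v v := fun v hv ↦ chartRep_pos (hR t ht') z ⟨y, hy⟩ v hv
  -- the decay of `|∇^{k+1}Rm|²` at `Φ y`, read in the chart at `z`
  have hU : tnormSq G b (tcovIter G b (k + 1) (rm4 G b)) y ≤ C' * (T - t) ^ (δ' - k - 3) := by
    have hsrc : (extChartAt (𝓡 4) z).symm y ∈ (extChartAt (𝓡 4) z).source :=
      (extChartAt (𝓡 4) z).map_target hy
    have h1 := hdec t ht ((extChartAt (𝓡 4) z).symm y)
    rw [curvDerivNormSq_eq_chart (hR t ht') hsrc (k + 1), (extChartAt (𝓡 4) z).right_inv hy,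
      curvD_eq_tcovIter, tnormSq_treindex] at h1
    exact h1
  -- `|∇^{k+1}Ric|² ≤ n |∇^{k+1}Rm|²`
  have hric : tnormSq G b (tcovIter G b (k + 1) (ric2 G b)) y ≤
      Fintype.card (Fin (finrank ℝ (EuclideanSpace ℝ (Fin 4)))) * (C' * (T - t) ^ (δ' - k - 3)) :=
    (hGm.tnormSq_tcovIter_ric2_le hy hposy (k + 1)).trans
      (mul_le_mul_of_nonneg_left hU (Nat.cast_nonneg _))
  -- the metric factors `g_{ii} ≤ Λ β² (T − t)`
  have happ : ∀ v w : EuclideanSpace ℝ (Fin 4), ((T - t)⁻¹ • G y) v w = (T - t)⁻¹ * G y v w :=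
    fun v w ↦ by simp only [_root_.smul_apply, smul_eq_mul]
  have hdiag : ∀ i, G y (b i) (b i) ≤ Λ * β ^ 2 * (T - t) := by
    intro i
    have hbi : ‖b i‖ ≤ β := Finset.single_le_sum (fun j _ ↦ norm_nonneg (b j)) (Finset.mem_univ i)
    have h1 := abs_apply₂_le ((T - t)⁻¹ • G y) (b i) (b i)
    rw [happ, abs_mul, abs_of_pos (inv_pos.2 hTt), abs_of_pos (hposy _ (b.ne_zero i)),
      inv_mul_le_iff₀ hTt] at h1
    have h3 : ‖(T - t)⁻¹ • G y‖ * ‖b i‖ * ‖b i‖ ≤ Λ * β * β :=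
      mul_le_mul (mul_le_mul hΛ hbi (norm_nonneg _) hΛ0) hbi (norm_nonneg _) (mul_nonneg hΛ0 hβ0)
    calc G y (b i) (b i) ≤ (T - t) * (‖(T - t)⁻¹ • G y‖ * ‖b i‖ * ‖b i‖) := h1
      _ ≤ (T - t) * (Λ * β * β) := mul_le_mul_of_nonneg_left h3 hTt.le
      _ = Λ * β ^ 2 * (T - t) := by ring
  have hprod : ∏ a, G y (b (J a)) (b (J a)) ≤ (Λ * β ^ 2 * (T - t)) ^ (k + 3) := by
    calc ∏ a, G y (b (J a)) (b (J a)) ≤ ∏ _a : Fin (k + 1) ⊕ Fin 2, Λ * β ^ 2 * (T - t) :=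
          Finset.prod_le_prod (fun a _ ↦ (hposy _ (b.ne_zero _)).le) fun a _ ↦ hdiag _
      _ = (Λ * β ^ 2 * (T - t)) ^ (k + 3) := by
          rw [Finset.prod_const, Finset.card_univ, Fintype.card_sum, Fintype.card_fin,
            Fintype.card_fin]
  have h1 := abs_apply_le_sqrt_prod_mul b hsy hposy (tcovIter G b (k + 1) (ric2 G b)) J
  -- bookkeeping of the powers of `T − t`
  have hpq : (T - t) ^ (k + 3) * (T - t) ^ (δ' - k - 3) = (T - t) ^ δ' := by
    rw [← rpow_natCast (T - t) (k + 3), ← rpow_add hTt]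
    congr 1
    push_cast
    ring
  have hsq : Real.sqrt ((T - t) ^ δ') = (T - t) ^ (δ' / 2) := by
    rw [sqrt_eq_rpow, ← rpow_mul hTt.le]
    congr 1
    ring
  have hA0 : 0 ≤ (Λ * β ^ 2 * (T - t)) ^ (k + 3) := pow_nonneg (by positivity) _
  have hK0 : 0 ≤ (Λ * β ^ 2) ^ (k + 3) * (Fintype.card (Fin (finrank ℝ (EuclideanSpace ℝ (Fin 4)))) * C') :=
    by positivity
  calc |tcovIter G b (k + 1) (ric2 G b) y J|
      ≤ Real.sqrt (∏ a, G y (b (J a)) (b (J a))) *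
          Real.sqrt (tnormSq G b (tcovIter G b (k + 1) (ric2 G b)) y) := h1
    _ ≤ Real.sqrt ((Λ * β ^ 2 * (T - t)) ^ (k + 3)) *
          Real.sqrt (Fintype.card (Fin (finrank ℝ (EuclideanSpace ℝ (Fin 4)))) *
            (C' * (T - t) ^ (δ' - k - 3))) :=
        mul_le_mul (Real.sqrt_le_sqrt hprod) (Real.sqrt_le_sqrt hric) (Real.sqrt_nonneg _)
          (Real.sqrt_nonneg _)
    _ = Real.sqrt ((Λ * β ^ 2) ^ (k + 3) *
          (Fintype.card (Fin (finrank ℝ (EuclideanSpace ℝ (Fin 4)))) * C') * (T - t) ^ δ') := by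
        rw [← Real.sqrt_mul hA0]
        congr 1
        rw [mul_pow, ← hpq]
        ring
    _ = Real.sqrt ((Λ * β ^ 2) ^ (k + 3) *
          (Fintype.card (Fin (finrank ℝ (EuclideanSpace ℝ (Fin 4)))) * C')) * (T - t) ^ (δ' / 2) := by
        rw [Real.sqrt_mul hK0, hsq]

end ChartData

/-! ### Main statement -/

/-- **HELPER `helper_scaledChart_data` — the chart data of the scaled metrics `g/(T−t)` near the
singular time** (layer S4a of `stub_smoothRoundLimit`; Hamilton 1982, §14, Lemma 14.2 and §17 read
in charts, Topping 2006, Lemma 5.3.2 and the dictionary of p. 47). Along a Ricci flow of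
Riemannian metrics on `[0, T)` on a closed 4-manifold with the roundness rates on `[t₀, T)` and the
decay `|∇^{k+1}Rm|² ≤ C'_k (T−t)^{δ'_k−k−3}` near `T`, every point `z` has a closed chart ball
`B̄(ẑ, r) ⊆ target` on which, for `t ∈ [t₀, T)`: (i) `λ|v|² ≤ G_t(y)(v,v)/(T−t)` and
`‖G_t(y)/(T−t)‖ ≤ Λ` (`scaledChartRep_twoSided`); (ii) the Einstein defect
`‖Ric(G_t)(y) − G_t(y)/(2(T−t))‖ ≤ C₀ (T−t)^δ` (`norm_ricAt_sub_smul_chartRep_le`); (iii) for every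
`k`, the components of `∇^{k+1}Ric(G_t)` decay like `(T−t)^{δ'_k/2}`
(`curvDerivNormSq_decay_from`, `abs_tcovIter_ric2_chartRep_le`).
[cite: Hamilton1982, §14, Lemma 14.2] [cite: Topping2006, Lemma 5.3.2] [cite: Topping2006, §5.3, p. 47] -/
theorem helper_scaledChart_data : ∀ (M : Type) [TopologicalSpace M] [T2Space M] [SecondCountableTopology M] [ChartedSpace (EuclideanSpace ℝ (Fin 4)) M] [IsManifold (𝓡 4) ∞ M] [CompactSpace M] (g : ℝ → PseudoRiemannianMetric (𝓡 4) ∞ (EuclideanSpace ℝ (Fin 4)) (TangentSpace (𝓡 4) : M → Type _)) (cov : ℝ → CovariantDerivative (𝓡 4) (EuclideanSpace ℝ (Fin 4)) (TangentSpace (𝓡 4) : M → Type _)) (T : ℝ), 0 < T → IsRicciFlow g cov (Ico 0 T) → (∀ t ∈ Ico 0 T, (g t).IsRiemannian) → ∀ (δ C t₀ : ℝ), 0 < δ → t₀ ∈ Ico 0 T → (∀ t ∈ Ico t₀ T, ∀ x : M, |(T - t) * (g t).scalarCurvatureWith (cov t) x - 2| ≤ C * (T - t) ^ δ ∧ (T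 - t) ^ 2 * ((g t).normSq x ((cov t).ricci x) - (g t).scalarCurvatureWith (cov t) x ^ 2 / 4) ≤ C * (T - t) ^ (2 * δ) ∧ (T - t) ^ 2 * ((g t).curvNormSqWith (cov t) x - 2 * (g t).normSq x ((cov t).ricci x) + (g t).scalarCurvatureWith (cov t) x ^ 2 / 3) ≤ C * (T - t) ^ δ) → (∀ k : ℕ, ∃ δ' C' t' : ℝ, 0 < δ' ∧ t' ∈ Ico 0 T ∧ ∀ t ∈ Ico t' T, ∀ x : M, curvDerivNormSq (𝓡 4) g (k + 1) t x ≤ C' * (T - t) ^ (δ' - k - 3)) → ∀ z : M, ∃ r t₁ lam Λ : ℝ, 0 < r ∧ t₁ ∈ Ico 0 T ∧ 0 < lam ∧ Metric.closedBall (extChartAt (𝓡 4) z z) r ⊆ (extChartAt (𝓡 4) z).target ∧ (∀ t ∈ Ico t₁ T, ∀ y ∈ Metric.closedBall (extChartAt (𝓡 4) z z) r, (∀ v : EuclideanSpace ℝ (Fin 4), lam * ‖v‖ ^ 2 ≤ (T - t)⁻¹ * chartRep (𝓡 4) g z t y v v) ∧ ‖(T - t)⁻¹ • chartRep (𝓡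 4) g z t y‖ ≤ Λ) ∧ (∃ δ₀ C₀ : ℝ, 0 < δ₀ ∧ ∀ t ∈ Ico t₁ T, ∀ y ∈ Metric.closedBall (extChartAt (𝓡 4) z z) r, ‖MetricCoord.ricAt (chartRep (𝓡 4) g z t) y - (2 * (T - t))⁻¹ • chartRep (𝓡 4) g z t y‖ ≤ C₀ * (T - t) ^ δ₀) ∧ (∀ k : ℕ, ∃ δk Ck : ℝ, 0 < δk ∧ ∀ t ∈ Ico t₁ T, ∀ y ∈ Metric.closedBall (extChartAt (𝓡 4) z z) r, ∀ J : Fin (k + 1) ⊕ Fin 2 → Fin (Module.finrank ℝ (EuclideanSpace ℝ (Fin 4))), |MetricCoord.tcovIter (chartRep (𝓡 4) g z t) (Module.finBasis ℝ (EuclideanSpace ℝ (Fin 4))) (k + 1) (MetricCoord.ric2 (chartRep (𝓡 4) g z t) (Module.finBasis ℝ (EuclideanSpace ℝ (Fin 4)))) y J| ≤ Ck * (T - t) ^ δk) := by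
  intro M _ _ _ _ _ _ g cov T hT hflow hR δ C t₀ hδ ht₀ hrate hdec z
  have hrate₂ : ∀ t ∈ Ico t₀ T, ∀ x : M,
      |(T - t) * (g t).scalarCurvatureWith (cov t) x - 2| ≤ C * (T - t) ^ δ ∧
      (T - t) ^ 2 * ((g t).normSq x ((cov t).ricci x) -
        (g t).scalarCurvatureWith (cov t) x ^ 2 / 4) ≤ C * (T - t) ^ (2 * δ) :=
    fun t ht x ↦ ⟨(hrate t ht x).1, (hrate t ht x).2.1⟩
  -- a closed chart ball inside the (open) chart target
  obtain ⟨ε, hε, hball⟩ := Metric.isOpen_iff.mp (isOpen_extChartAt_target (I := 𝓡 4) z)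
    (extChartAt (𝓡 4) z z) (mem_extChartAt_target z)
  have hr : 0 < ε / 2 := half_pos hε
  have hcl : closedBall (extChartAt (𝓡 4) z z) (ε / 2) ⊆ (extChartAt (𝓡 4) z).target :=
    (closedBall_subset_ball (half_lt_self hε)).trans hball
  -- (i) the two-sided bounds
  obtain ⟨lam, Λ, hlam, hGb⟩ := scaledChartRep_twoSided hflow hR hδ ht₀ hrate₂ z hr.le hcl
  refine ⟨ε / 2, t₀, lam, Λ, hr, ht₀, hlam, hcl, hGb, ?_, fun k ↦ ?_⟩
  · -- (ii) the Einstein defect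
    refine ⟨δ, Real.sqrt (C ^ 2 + 4 * C) * Λ, hδ, fun t ht y hy ↦ ?_⟩
    exact norm_ricAt_sub_smul_chartRep_le hflow hR ht₀ hrate₂ z (hcl hy) ht (hGb t ht y hy).2
  · -- (iii) the covariant Ricci derivatives
    obtain ⟨δ', C', t', hδ', ht', hb⟩ := hdec k
    obtain ⟨C'', hC'', hb'⟩ := curvDerivNormSq_decay_from hflow hR ht₀ ht' hb
    refine ⟨δ' / 2, Real.sqrt ((Λ * (∑ i, ‖finBasis ℝ (EuclideanSpace ℝ (Fin 4)) i‖) ^ 2) ^ (k + 3) *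
      (Fintype.card (Fin (finrank ℝ (EuclideanSpace ℝ (Fin 4)))) * C'')), half_pos hδ',
      fun t ht y hy J ↦ ?_⟩
    exact abs_tcovIter_ric2_chartRep_le hR ht₀ hC'' hb' z (hcl hy) ht (hGb t ht y hy).2 J

end Literature.Geometry.Riemannian.HamiltonPinchedFlow

end Part4

/-!
## Part 5 — port of `Summits/SmoothPoincare4/SmoothPoincare4/Theorems/EntropyRungChangGurskyYangStubSmoothRoundLimitChartBounds.lean` (1 declarations kept)

# Uniform `Cᵐ` bounds and the Cauchy property of the scaled chart representative (Hamilton 1982, Lemma 14.2, Cor. 17.10)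

Declarations of this Part (verbatim port; each keeps its own docstring and citation): `helper_scaledChart_bounds`.

References: R. S. Hamilton, *Three-manifolds with positive Ricci curvature*, J. Differential Geom. 17 (1982) 255–306 [Hamilton1982]; P. Topping, *Lectures on the Ricci flow*, LMS Lecture Note Series 325, CUP 2006 [Topping2006]; B. Chow, D. Knopf, *The Ricci Flow: An Introduction*, AMS 2004 [ChowKnopf2004].
-/

section Part5

set_option maxSynthPendingDepth 3

open _root_.Set _root_.Function _root_.Filter
open scoped _root_.Manifold _root_.ContDiff _root_.Topology

namespace Literature.Geometry.Riemannian.HamiltonPinchedFlow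

open Literature.Geometry.Riemannian
open Literature.Geometry.Lorentzian Literature.Geometry.Lorentzian.PseudoRiemannianMetric

/-- **Uniform `Cᵐ` bounds and the Cauchy property as `t ↑ T` of the scaled chart representative
`G̃(t) = (T − t)⁻¹ · chartRep (𝓡 4) g z t`** (layer S4b of `stub_smoothRoundLimit`): from the
chart data (two-sided bounds of `G̃`, decay of the Einstein defect and of the components of all
`∇ᵏ⁺¹Ric` on a closed chart ball near `T`) at every point, on a smaller chart ball and for later
times all `∂ᵐ_y G̃(·, t)` are bounded and uniformly Cauchy as `t ↑ T` (Hamilton 1982, §14,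
Lemma 14.2 / §17, Cor. 17.10 by the graded induction of Chow–Knopf 2004, §6.7 with integrable
rates; `IsRicciFlow.scaledChartRep_bounded_and_cauchy` specialised to the model `𝓡 4`).
[cite: Hamilton1982, §14, Lemma 14.2] [cite: Hamilton1982, §17, Cor. 17.10]
[cite: Topping2006, §5.3, pp. 47–48] [cite: ChowKnopf2004, §6.7] -/
theorem helper_scaledChart_bounds : ∀ (M : Type) [TopologicalSpace M] [T2Space M] [SecondCountableTopology M] [ChartedSpace (EuclideanSpace ℝ (Fin 4)) M] [IsManifold (𝓡 4) ∞ M] [CompactSpace M] (g : ℝ → PseudoRiemannianMetric (𝓡 4) ∞ (EuclideanSpace ℝ (Fin 4)) (TangentSpace (𝓡 4) : M → Type _)) (cov : ℝ → CovariantDerivative (𝓡 4) (EuclideanSpace ℝ (Fin 4)) (TangentSpace (𝓡 4) : M → Type _)) (T : ℝ), 0 < T → IsRicciFlow g cov (Ico 0 T) → (∀ t ∈ Ico 0 T, (g t).IsRiemannian) → (∀ z : M, ∃ r t₁ lam Λ : ℝ, 0 < r ∧ t₁ ∈ Ico 0 T ∧ 0 < lam ∧ Metric.closedBall (extChartAt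 (𝓡 4) z z) r ⊆ (extChartAt (𝓡 4) z).target ∧ (∀ t ∈ Ico t₁ T, ∀ y ∈ Metric.closedBall (extChartAt (𝓡 4) z z) r, (∀ v : EuclideanSpace ℝ (Fin 4), lam * ‖v‖ ^ 2 ≤ (T - t)⁻¹ * chartRep (𝓡 4) g z t y v v) ∧ ‖(T - t)⁻¹ • chartRep (𝓡 4) g z t y‖ ≤ Λ) ∧ (∃ δ₀ C₀ : ℝ, 0 < δ₀ ∧ ∀ t ∈ Ico t₁ T, ∀ y ∈ Metric.closedBall (extChartAt (𝓡 4) z z) r, ‖MetricCoord.ricAt (chartRep (𝓡 4) g z t) y - (2 * (T - t))⁻¹ • chartRep (𝓡 4) g z t y‖ ≤ C₀ * (T - t) ^ δ₀) ∧ (∀ k : ℕ, ∃ δk Ck : ℝ, 0 < δk ∧ ∀ t ∈ Ico t₁ T, ∀ y ∈ Metric.closedBall (extChartAt (𝓡 4) z z) r, ∀ J : Fin (k + 1) ⊕ Fin 2 → Fin (Module.finrank ℝ (EuclideanSpace ℝ (Fin 4))), |MetricCoord.tcovIter (chartRep (𝓡 4) g z t) (Module.finBasis ℝ (EuclideanSpace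 ℝ (Fin 4))) (k + 1) (MetricCoord.ric2 (chartRep (𝓡 4) g z t) (Module.finBasis ℝ (EuclideanSpace ℝ (Fin 4)))) y J| ≤ Ck * (T - t) ^ δk)) → ∀ z : M, ∃ r t₁ lam : ℝ, 0 < r ∧ t₁ ∈ Ico 0 T ∧ 0 < lam ∧ Metric.closedBall (extChartAt (𝓡 4) z z) r ⊆ (extChartAt (𝓡 4) z).target ∧ (∀ t ∈ Ico t₁ T, ∀ y ∈ Metric.closedBall (extChartAt (𝓡 4) z z) r, ∀ v : EuclideanSpace ℝ (Fin 4), lam * ‖v‖ ^ 2 ≤ (T - t)⁻¹ * chartRep (𝓡 4) g z t y v v) ∧ (∀ m : ℕ, ∃ Cm : ℝ, ∀ t ∈ Ico t₁ T, ∀ y ∈ Metric.ball (extChartAt (𝓡 4) z z) r, ‖iteratedFDeriv ℝ m (fun y : EuclideanSpace ℝ (Fin 4) ↦ (T - t)⁻¹ • chartRep (𝓡 4) g z t y) y‖ ≤ Cm) ∧ (∀ m : ℕ, ∀ ε : ℝ, 0 < ε → ∃ t₂ ∈ Ico t₁ T, ∀ t ∈ Ico t₂ T, ∀ t' ∈ Ico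 t₂ T, ∀ y ∈ Metric.ball (extChartAt (𝓡 4) z z) r, ‖iteratedFDeriv ℝ m (fun y : EuclideanSpace ℝ (Fin 4) ↦ (T - t)⁻¹ • chartRep (𝓡 4) g z t y) y - iteratedFDeriv ℝ m (fun y : EuclideanSpace ℝ (Fin 4) ↦ (T - t')⁻¹ • chartRep (𝓡 4) g z t' y) y‖ ≤ ε) := by
  intro M _ _ _ _ _ _ g cov T hT hflow _ hdata z
  exact hflow.scaledChartRep_bounded_and_cauchy hT hdata z

end Literature.Geometry.Riemannian.HamiltonPinchedFlow

end Part5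

/-!
## Part 6 — port of `Summits/SmoothPoincare4/SmoothPoincare4/Theorems/EntropyRungChangGurskyYangStubSmoothRoundLimitLimitMetric.lean` (9 declarations kept)

# The smooth limit metric `g' = lim_{t ↑ T} g(t)/(T − t)` (Hamilton 1982, §14 and §17, Cor. 17.10)

Declarations of this Part (verbatim port; each keeps its own docstring and citation): `uniformCauchySeqOn_nhdsLT_of_forall`, `exists_Ico_of_eventually_nhdsLT`, `exists_contDiffOn_limit_of_uniformCauchySeqOn`, `exists_field_of_tendsto_gramOpFamily`, `chartRepRaw_eq_of_tendsto`, `pos_of_tendsto_of_lowerBound`, `contMDiff_totalSpaceMk_of_chartRepRaw_eqOn`, `exists_scaledLimit_metric`, `helper_scaledLimit_metric`.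

References: R. S. Hamilton, *Three-manifolds with positive Ricci curvature*, J. Differential Geom. 17 (1982) 255–306 [Hamilton1982]; P. Topping, *Lectures on the Ricci flow*, LMS Lecture Note Series 325, CUP 2006 [Topping2006].
-/

section Part6

set_option maxSynthPendingDepth 3

open _root_.Set _root_.Function _root_.Filter _root_.Metric
open scoped _root_.Manifold _root_.ContDiff _root_.Topology

namespace Literature.Geometry.Riemannian.HamiltonPinchedFlow

open Literature.Geometry.Riemannian
open Literature.Geometry.Lorentzian Literature.Geometry.Lorentzian.PseudoRiemannianMetric

/-! ### Analysis: smooth limits along `𝓝[<] T` of families uniformly Cauchy in every `Cᵐ` -/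

section Analysis

variable {P : Type*} [NormedAddCommGroup P] [NormedSpace ℝ P] {G : Type*} [NormedAddCommGroup G]

/-- From "`ε`–`t₂`" Cauchy control as `t ↑ T` to a uniformly Cauchy family along `𝓝[<] T`.
[cite: Hamilton1982, §17, Cor. 17.10] -/
theorem uniformCauchySeqOn_nhdsLT_of_forall {X : Type*} {F : ℝ → X → G} {s : Set X} {T t₁ : ℝ}
    (h : ∀ ε : ℝ, 0 < ε → ∃ t₂ ∈ Ico t₁ T, ∀ t ∈ Ico t₂ T, ∀ t' ∈ Ico t₂ T, ∀ y ∈ s,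
      ‖F t y - F t' y‖ ≤ ε) :
    UniformCauchySeqOn F (𝓝[<] T) s := by
  intro u hu
  obtain ⟨ε, hε, hεu⟩ := Metric.mem_uniformity_dist.1 hu
  obtain ⟨t₂, ht₂, hb⟩ := h (ε / 2) (half_pos hε)
  have hmem : Ico t₂ T ∈ 𝓝[<] T := Ico_mem_nhdsLT ht₂.2
  filter_upwards [prod_mem_prod hmem hmem] with p hp y hy
  exact hεu (by rw [dist_eq_norm]; linarith [hb p.1 hp.1 p.2 hp.2 y hy])

/-- "Eventually as `t ↑ T`" (`0 < T`) means: on some `[t₂, T)` with `t₂ ∈ [0, T)`.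
[cite: Hamilton1982, §17, Cor. 17.10] -/
theorem exists_Ico_of_eventually_nhdsLT {T : ℝ} (hT : 0 < T) {p : ℝ → Prop}
    (h : ∀ᶠ t in 𝓝[<] T, p t) : ∃ t₂ ∈ Ico 0 T, ∀ t ∈ Ico t₂ T, p t := by
  obtain ⟨l, hlT, hl⟩ := mem_nhdsLT_iff_exists_Ioo_subset.1 h
  have hlT' : l < T := hlT
  refine ⟨max 0 ((l + T) / 2), ⟨le_max_left _ _, max_lt hT (by linarith)⟩, fun t ht ↦ hl ⟨?_, ht.2⟩⟩
  exact lt_of_lt_of_le (by linarith) ((le_max_right _ _).trans ht.1)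

variable [NormedSpace ℝ G] [CompleteSpace G]

/-- **Smooth limits of families uniformly Cauchy in every `Cᵐ`** (Dieudonné (8.6.3), iterated —
the tree's `Literature.Analysis.Calculus.ContDiffUniformLimit` — along the filter `𝓝[<] T`): if
the `F t` are `C^∞` on the open set `U` and, for every `m`, the derivatives `D^m (F t)` are
uniformly Cauchy on `U` as `t ↑ T`, then there is a `C^∞` map `G₀` on `U` with `F t → G₀`
pointwise on `U` and `D^m (F t) → D^m G₀` uniformly on `U`, for every `m`. This is the analysis
behind "the metrics converge in `C^∞` to a smooth limit metric".
[cite: Hamilton1982, §14, Lemma 14.2] -/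
theorem exists_contDiffOn_limit_of_uniformCauchySeqOn {U : Set P} (hU : IsOpen U)
    {F : ℝ → P → G} {T : ℝ} (hF : ∀ t, ContDiffOn ℝ ∞ (F t) U)
    (hc : ∀ m : ℕ, UniformCauchySeqOn (fun t ↦ iteratedFDeriv ℝ m (F t)) (𝓝[<] T) U) :
    ∃ G₀ : P → G, ContDiffOn ℝ ∞ G₀ U ∧
      (∀ y ∈ U, Tendsto (fun t ↦ F t y) (𝓝[<] T) (𝓝 (G₀ y))) ∧
      ∀ m : ℕ, TendstoUniformlyOn (fun t ↦ iteratedFDeriv ℝ m (F t)) (iteratedFDeriv ℝ m G₀)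
        (𝓝[<] T) U := by
  obtain ⟨G₀, p, -, hpt, hlim⟩ :=
    Literature.Analysis.Calculus.exists_tendstoUniformlyOn_of_uniformCauchySeqOn_iteratedFDeriv
      (l := 𝓝[<] T) (N := (⊤ : ℕ∞)) (f := F) (U := U) (fun m _ ↦ hc m)
  refine ⟨G₀, Literature.Analysis.Calculus.contDiffOn_of_tendstoUniformlyOn_iteratedFDeriv hU hF
    hlim hpt, hpt, fun m ↦ ?_⟩
  exact Literature.Analysis.Calculus.tendstoUniformlyOn_iteratedFDeriv_of_tendstoUniformlyOn hU
    hF hlim hpt (m := m) (by exact_mod_cast le_top)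

end Analysis

/-! ### Geometry: the limit field of bilinear forms and its chart representatives -/

section Geometry

variable {E : Type*} [NormedAddCommGroup E] [NormedSpace ℝ E] {H : Type*} [TopologicalSpace H]
  {I : ModelWithCorners ℝ E H} {M : Type*} [TopologicalSpace M] [ChartedSpace H M]
  [IsManifold I ∞ M]
  {g : ℝ → PseudoRiemannianMetric I ∞ E (TangentSpace I : M → Type _)} {l : Filter ℝ}

/-- **The limit field of bilinear forms** (as `limitVal` of `RicciFlowSmoothExtension.lean`, for
a rescaled family): if, at every point `x`, the rescaled Gram operators
`c(t) • gramOpFamily I g x (x, t)` converge along `l` to `A x`, then the forms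
`v_x = A x ∘ (e_x × e_x)` (`e_x` the trivialization of `TM` at `x`, read at `x`) have the
coefficients `v_x(X, Y) = lim c(t) g_t(x)(X, Y)`. [cite: Topping2006, §5.3, p. 47] -/
theorem exists_field_of_tendsto_gramOpFamily (c : ℝ → ℝ) (A : M → E →L[ℝ] E →L[ℝ] ℝ)
    (hA : ∀ x : M, Tendsto (fun t ↦ c t • gramOpFamily I g x (x, t)) l (𝓝 (A x))) :
    ∃ v : (x : M) → TangentSpace I x →L[ℝ] TangentSpace I x →L[ℝ] ℝ,
      ∀ (x : M) (X Y : TangentSpace I x),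
        Tendsto (fun t ↦ c t * (g t).val x X Y) l (𝓝 (v x X Y)) := by
  refine ⟨fun x ↦ show TangentSpace I x →L[ℝ] TangentSpace I x →L[ℝ] ℝ from
    (ContinuousLinearMap.bilinearComp (A x)
      (show E →L[ℝ] E from
        (trivializationAt E (TangentSpace I : M → Type _) x).continuousLinearMapAt ℝ x)
      (show E →L[ℝ] E from
        (trivializationAt E (TangentSpace I : M → Type _) x).continuousLinearMapAt ℝ x) :
      E →L[ℝ] E →L[ℝ] ℝ), fun x X Y ↦ ?_⟩
  have h := tendsto_apply₂_of_tendsto (hA x)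
    ((trivializationAt E (TangentSpace I : M → Type _) x).continuousLinearMapAt ℝ x X)
    ((trivializationAt E (TangentSpace I : M → Type _) x).continuousLinearMapAt ℝ x Y)
  simp only [_root_.smul_apply, gramOpFamily_apply_continuousLinearMapAt, smul_eq_mul] at h
  exact h

variable [l.NeBot]

/-- **The representative of the limit field in any chart is the limit of the scaled
representatives**: if `v_x(X, Y) = lim c(t) g_t(x)(X, Y)` everywhere and `c(t) • G_t(y) → L` in
the chart at `z`, then `chartRepRaw v z · y = L` (entries are fixed linear functions of the
coefficients at `Φ y`; limits are unique). [cite: Topping2006, §5.3, p. 47] -/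
theorem chartRepRaw_eq_of_tendsto {c : ℝ → ℝ}
    {v : (x : M) → TangentSpace I x →L[ℝ] TangentSpace I x →L[ℝ] ℝ}
    (hv : ∀ (x : M) (X Y : TangentSpace I x), Tendsto (fun t ↦ c t * (g t).val x X Y) l (𝓝 (v x X Y)))
    {z : M} {y : E} {L : E →L[ℝ] E →L[ℝ] ℝ}
    (hL : Tendsto (fun t ↦ c t • chartRep I g z t y) l (𝓝 L)) (s : ℝ) :
    chartRepRaw (fun (_ : ℝ) (b : M) ↦ v b) z s y = L := by
  ext a b
  rw [chartRepRaw_apply]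
  exact tendsto_nhds_unique (hv _ _ _) (tendsto_apply₂_of_tendsto hL a b)

/-- **Positivity of the limit field** from a uniform lower bound at the centre of the chart:
if eventually `λ‖w‖² ≤ c(t) G_t(x̂)(w, w)` for all `w` (`λ > 0`, `x̂ = extChartAt I x x`), then
`v_x(X, X) > 0` for `X ≠ 0`. [cite: Hamilton1982, §14, Lemma 14.2] -/
theorem pos_of_tendsto_of_lowerBound {c : ℝ → ℝ}
    {v : (x : M) → TangentSpace I x →L[ℝ] TangentSpace I x →L[ℝ] ℝ}
    (hv : ∀ (x : M) (X Y : TangentSpace I x), Tendsto (fun t ↦ c t * (g t).val x X Y) l (𝓝 (v x X Y)))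
    (x : M) {lam : ℝ} (hlam : 0 < lam)
    (hpos : ∀ᶠ t in l, ∀ w : E, lam * ‖w‖ ^ 2 ≤ c t * chartRep I g x t (extChartAt I x x) w w)
    {X : TangentSpace I x} (hX : X ≠ 0) : 0 < v x X X := by
  have hx : x ∈ (trivializationAt E (TangentSpace I : M → Type _) x).baseSet :=
    FiberBundle.mem_baseSet_trivializationAt E (TangentSpace I : M → Type _) x
  set w : E := (trivializationAt E (TangentSpace I : M → Type _) x).continuousLinearMapAt ℝ x X
    with hw_def
  have hw : w ≠ 0 := by
    intro hw0
    apply hX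
    rw [← (trivializationAt E (TangentSpace I : M → Type _) x).symmL_continuousLinearMapAt
      (R := ℝ) hx X, ← hw_def, hw0, map_zero]
  have hle : lam * ‖w‖ ^ 2 ≤ v x X X := by
    refine ge_of_tendsto (hv x X X) ?_
    filter_upwards [hpos] with t ht
    have h := ht w
    rwa [hw_def, chartRep_extChartAt_self, gramOpFamily_apply_continuousLinearMapAt] at h
  have hwn : 0 < ‖w‖ := norm_pos_iff.2 hw
  exact lt_of_lt_of_le (by positivity) hle

omit [l.NeBot] in
/-- **Smoothness of a field of bilinear forms whose chart representatives are smooth near the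
centres** (the local chart criterion `contMDiffOn_totalSpaceMk_of_chartRepRaw`, Topping 2006,
§1.2.3, for a time-independent field). [cite: Topping2006, §1.2.3] -/
theorem contMDiff_totalSpaceMk_of_chartRepRaw_eqOn
    (v : (x : M) → TangentSpace I x →L[ℝ] TangentSpace I x →L[ℝ] ℝ)
    (h : ∀ z : M, ∃ U ∈ 𝓝 (extChartAt I z z), ∃ G₀ : E → (E →L[ℝ] E →L[ℝ] ℝ),
      ContDiffOn ℝ ∞ G₀ U ∧ ∀ y ∈ U, chartRepRaw (fun (_ : ℝ) (b : M) ↦ v b) z 0 y = G₀ y) :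
    ContMDiff I (I.prod 𝓘(ℝ, E →L[ℝ] E →L[ℝ] ℝ)) ∞
      (fun b : M ↦ Bundle.TotalSpace.mk' (E →L[ℝ] E →L[ℝ] ℝ)
        (E := fun b : M ↦ TangentSpace I b →L[ℝ] TangentSpace I b →L[ℝ] ℝ) b (v b)) := by
  have hfam := contMDiffOn_totalSpaceMk_of_chartRepRaw (I := I) (S := (univ : Set ℝ))
    (fun (_ : ℝ) (b : M) ↦ v b) fun z ↦ by
      obtain ⟨U, hU, G₀, hG₀, heq⟩ := h z
      refine ⟨U, hU, ?_⟩
      have h1 : ContDiffOn ℝ ∞ (fun q : E × ℝ ↦ G₀ q.1) (U ×ˢ (univ : Set ℝ)) :=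
        hG₀.comp contDiffOn_fst fun q hq ↦ hq.1
      exact h1.congr fun q hq ↦ heq q.1 hq.1
  have hι : ContMDiff I (I.prod 𝓘(ℝ, ℝ)) ∞ (fun b : M ↦ ((b, (0 : ℝ)) : M × ℝ)) :=
    contMDiff_id.prodMk contMDiff_const
  exact hfam.comp_contMDiff hι fun b ↦ ⟨mem_univ _, mem_univ _⟩

end Geometry

/-! ### The smooth limit metric -/

section LimitMetric

variable {E : Type*} [NormedAddCommGroup E] [NormedSpace ℝ E] [FiniteDimensional ℝ E]
  {H : Type*} [TopologicalSpace H] {I : ModelWithCorners ℝ E H}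
  {M : Type*} [TopologicalSpace M] [ChartedSpace H M] [IsManifold I ∞ M]
  {g : ℝ → PseudoRiemannianMetric I ∞ E (TangentSpace I : M → Type _)} {T : ℝ}

/-- **The smooth limit metric of a family whose scaled chart representatives are uniformly
positive and uniformly Cauchy in every `Cᵐ`** (Hamilton 1982, Lemma 14.2 / Cor. 17.10; Topping
2006, p. 47, for the scaled family `g(t)/(T − t)`): there is a `C^∞` Riemannian metric `g'` with
`D^m [(T − t)⁻¹ G_t] → D^m [chartRep g' z]` uniformly on `B(ẑ, r)` as `t ↑ T`, every `m`, every
`z`. [cite: Hamilton1982, §14, Lemma 14.2] [cite: Hamilton1982, §17, Cor. 17.10]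
[cite: Topping2006, §5.3, p. 47] -/
theorem exists_scaledLimit_metric (hT : 0 < T)
    (hbounds : ∀ z : M, ∃ r t₁ lam : ℝ, 0 < r ∧ t₁ ∈ Ico 0 T ∧ 0 < lam ∧
      closedBall (extChartAt I z z) r ⊆ (extChartAt I z).target ∧
      (∀ t ∈ Ico t₁ T, ∀ y ∈ closedBall (extChartAt I z z) r, ∀ v : E,
        lam * ‖v‖ ^ 2 ≤ (T - t)⁻¹ * chartRep I g z t y v v) ∧
      (∀ m : ℕ, ∀ ε : ℝ, 0 < ε → ∃ t₂ ∈ Ico t₁ T, ∀ t ∈ Ico t₂ T, ∀ t' ∈ Ico t₂ T,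
        ∀ y ∈ ball (extChartAt I z z) r,
          ‖iteratedFDeriv ℝ m (fun y : E ↦ (T - t)⁻¹ • chartRep I g z t y) y -
            iteratedFDeriv ℝ m (fun y : E ↦ (T - t')⁻¹ • chartRep I g z t' y) y‖ ≤ ε)) :
    ∃ g' : PseudoRiemannianMetric I ∞ E (TangentSpace I : M → Type _), g'.IsRiemannian ∧
      ∀ z : M, ∃ r : ℝ, 0 < r ∧ closedBall (extChartAt I z z) r ⊆ (extChartAt I z).target ∧
        ∀ m : ℕ, ∀ ε : ℝ, 0 < ε → ∃ t₂ ∈ Ico 0 T, ∀ t ∈ Ico t₂ T,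
          ∀ y ∈ ball (extChartAt I z z) r,
            ‖iteratedFDeriv ℝ m (fun y : E ↦ (T - t)⁻¹ • chartRep I g z t y) y -
              iteratedFDeriv ℝ m (fun y : E ↦ chartRep I (fun _ : ℝ ↦ g') z 0 y) y‖ ≤ ε := by
  choose r t₁ lam hr ht₁ hlam hball hpos hcauchy using hbounds
  have hballsub : ∀ z, ball (extChartAt I z z) (r z) ⊆ (extChartAt I z).target :=
    fun z ↦ ball_subset_closedBall.trans (hball z)
  -- (1) the smooth limits of the scaled representatives, chart by chart
  have hlimit : ∀ z : M, ∃ G₀ : E → (E →L[ℝ] E →L[ℝ] ℝ),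
      ContDiffOn ℝ ∞ G₀ (ball (extChartAt I z z) (r z)) ∧
      (∀ y ∈ ball (extChartAt I z z) (r z),
        Tendsto (fun t ↦ (T - t)⁻¹ • chartRep I g z t y) (𝓝[<] T) (𝓝 (G₀ y))) ∧
      ∀ m : ℕ, TendstoUniformlyOn
        (fun t ↦ iteratedFDeriv ℝ m (fun y : E ↦ (T - t)⁻¹ • chartRep I g z t y))
        (iteratedFDeriv ℝ m G₀) (𝓝[<] T) (ball (extChartAt I z z) (r z)) := fun z ↦
    exists_contDiffOn_limit_of_uniformCauchySeqOn isOpen_ball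
      (F := fun t y ↦ (T - t)⁻¹ • chartRep I g z t y)
      (fun t ↦ ((contDiffOn_chartRep_const (g t) z).mono (hballsub z)).const_smul (T - t)⁻¹)
      (fun m ↦ uniformCauchySeqOn_nhdsLT_of_forall (hcauchy z m))
  choose G hGsm hGpt hGunif using hlimit
  -- (2) the limit field `v` and its coefficients
  obtain ⟨v, hv⟩ : ∃ v : (x : M) → TangentSpace I x →L[ℝ] TangentSpace I x →L[ℝ] ℝ,
      ∀ (x : M) (X Y : TangentSpace I x),
        Tendsto (fun t ↦ (T - t)⁻¹ * (g t).val x X Y) (𝓝[<] T) (𝓝 (v x X Y)) := by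
    refine exists_field_of_tendsto_gramOpFamily (fun t ↦ (T - t)⁻¹)
      (fun x ↦ G x (extChartAt I x x)) fun x ↦ ?_
    have h := hGpt x (extChartAt I x x) (mem_ball_self (hr x))
    simp only [chartRep_extChartAt_self] at h
    exact h
  -- (3) the representatives of `v` are the limits `G z` on the balls
  have hGeq : ∀ z : M, ∀ y ∈ ball (extChartAt I z z) (r z), ∀ s : ℝ,
      chartRepRaw (fun (_ : ℝ) (b : M) ↦ v b) z s y = G z y :=
    fun z y hy s ↦ chartRepRaw_eq_of_tendsto hv (hGpt z y hy) s
  -- (4) the metric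
  have hsymm : ∀ (x : M) (X Y : TangentSpace I x), v x X Y = v x Y X := fun x X Y ↦ by
    refine tendsto_nhds_unique (hv x X Y) ?_
    have h := hv x Y X
    simp only [(g _).symm x Y X] at h
    exact h
  have hvpos : ∀ (x : M) (X : TangentSpace I x), X ≠ 0 → 0 < v x X X := fun x X hX ↦ by
    refine pos_of_tendsto_of_lowerBound hv x (hlam x) ?_ hX
    filter_upwards [Ico_mem_nhdsLT (ht₁ x).2] with t ht
    exact hpos x t ht _ (mem_closedBall_self (hr x).le)
  have hsmooth := contMDiff_totalSpaceMk_of_chartRepRaw_eqOn v fun z ↦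
    ⟨ball (extChartAt I z z) (r z), ball_mem_nhds _ (hr z), G z, hGsm z,
      fun y hy ↦ hGeq z y hy 0⟩
  let g' : PseudoRiemannianMetric I ∞ E (TangentSpace I : M → Type _) :=
    { val := v
      symm := hsymm
      nondegenerate := fun b X hX ↦ by
        by_contra hne
        exact (hvpos b X hne).ne' (hX X)
      contMDiff := hsmooth }
  have hg'val : g'.val = v := rfl
  -- (5) the representative of `g'` in the chart at `z` is `G z` on the ball
  have hrep : ∀ z : M, ∀ y ∈ ball (extChartAt I z z) (r z),
      chartRep I (fun _ : ℝ ↦ g') z 0 y = G z y := fun z y hy ↦ by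
    rw [← hGeq z y hy 0]
    ext a b
    simp only [chartRep_eq_chartRepRaw, chartRepRaw_apply, hg'val]
  refine ⟨g', fun b X hX ↦ hvpos b X hX, fun z ↦ ⟨r z, hr z, hball z, fun m ε hε ↦ ?_⟩⟩
  obtain ⟨t₂, ht₂, hP⟩ := exists_Ico_of_eventually_nhdsLT hT
    (Metric.tendstoUniformlyOn_iff.1 (hGunif z m) ε hε)
  refine ⟨t₂, ht₂, fun t ht y hy ↦ ?_⟩
  have hEq : (fun y : E ↦ chartRep I (fun _ : ℝ ↦ g') z 0 y) =ᶠ[𝓝 y] G z := by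
    filter_upwards [isOpen_ball.mem_nhds hy] with y' hy' using hrep z y' hy'
  rw [(hEq.iteratedFDeriv ℝ m).eq_of_nhds, ← dist_eq_norm, dist_comm]
  exact (hP t ht y hy).le

end LimitMetric

/-- **HELPER `helper_scaledLimit_metric` — the smooth limit metric `g' = lim g(t)/(T − t)`**
(layer S5a of `stub_smoothRoundLimit`; Hamilton 1982, §14, Lemma 14.2 and §17, Cor. 17.10;
Topping 2006, p. 47): along a Ricci flow of Riemannian metrics on `[0, T)` on a closed manifold
with `4`-dimensional model, if the scaled chart representatives `(T − t)⁻¹ G_t` are, near every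
point, uniformly positive definite, bounded in every `Cᵐ` and uniformly Cauchy in every `Cᵐ` as
`t ↑ T` (the conclusion of `helper_scaledChart_bounds`), then there is a `C^∞` Riemannian metric
`g'` on `M` to whose chart representatives the scaled representatives converge with all
derivatives, uniformly on a ball about every chart centre (`exists_scaledLimit_metric`).
[cite: Hamilton1982, §14, Lemma 14.2] [cite: Hamilton1982, §17, Cor. 17.10]
[cite: Topping2006, §5.3, p. 47] -/
theorem helper_scaledLimit_metric : ∀ (M : Type) [TopologicalSpace M] [T2Space M] [SecondCountableTopology M] [ChartedSpace (EuclideanSpace ℝ (Fin 4)) M] [IsManifold (𝓡 4) ∞ M] [CompactSpace M] (g : ℝ → PseudoRiemannianMetric (𝓡 4) ∞ (EuclideanSpace ℝ (Fin 4)) (TangentSpace (𝓡 4) : M → Type _)) (cov : ℝ → CovariantDerivative (𝓡 4) (EuclideanSpace ℝ (Fin 4)) (TangentSpace (𝓡 4) : M → Type _)) (T : ℝ), 0 < T → IsRicciFlow g cov (Ico 0 T) → (∀ t ∈ Ico 0 T, (g t).IsRiemannian) → (∀ z : M, ∃ r t₁ lam : ℝ, 0 < r ∧ t₁ ∈ Ico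 0 T ∧ 0 < lam ∧ Metric.closedBall (extChartAt (𝓡 4) z z) r ⊆ (extChartAt (𝓡 4) z).target ∧ (∀ t ∈ Ico t₁ T, ∀ y ∈ Metric.closedBall (extChartAt (𝓡 4) z z) r, ∀ v : EuclideanSpace ℝ (Fin 4), lam * ‖v‖ ^ 2 ≤ (T - t)⁻¹ * chartRep (𝓡 4) g z t y v v) ∧ (∀ m : ℕ, ∃ Cm : ℝ, ∀ t ∈ Ico t₁ T, ∀ y ∈ Metric.ball (extChartAt (𝓡 4) z z) r, ‖iteratedFDeriv ℝ m (fun y : EuclideanSpace ℝ (Fin 4) ↦ (T - t)⁻¹ • chartRep (𝓡 4) g z t y) y‖ ≤ Cm) ∧ (∀ m : ℕ, ∀ ε : ℝ, 0 < ε → ∃ t₂ ∈ Ico t₁ T, ∀ t ∈ Ico t₂ T, ∀ t' ∈ Ico t₂ T, ∀ y ∈ Metric.ball (extChartAt (𝓡 4) z z) r, ‖iteratedFDeriv ℝ m (fun y : EuclideanSpace ℝ (Fin 4) ↦ (T - t)⁻¹ • chartRep (𝓡 4) g z t y) y - iteratedFDeriv ℝ m (fun y : EuclideanSpace ℝ (Fin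 4) ↦ (T - t')⁻¹ • chartRep (𝓡 4) g z t' y) y‖ ≤ ε)) → ∃ g' : PseudoRiemannianMetric (𝓡 4) ∞ (EuclideanSpace ℝ (Fin 4)) (TangentSpace (𝓡 4) : M → Type _), g'.IsRiemannian ∧ ∀ z : M, ∃ r : ℝ, 0 < r ∧ Metric.closedBall (extChartAt (𝓡 4) z z) r ⊆ (extChartAt (𝓡 4) z).target ∧ ∀ m : ℕ, ∀ ε : ℝ, 0 < ε → ∃ t₂ ∈ Ico 0 T, ∀ t ∈ Ico t₂ T, ∀ y ∈ Metric.ball (extChartAt (𝓡 4) z z) r, ‖iteratedFDeriv ℝ m (fun y : EuclideanSpace ℝ (Fin 4) ↦ (T - t)⁻¹ • chartRep (𝓡 4) g z t y) y - iteratedFDeriv ℝ m (fun y : EuclideanSpace ℝ (Fin 4) ↦ chartRep (𝓡 4) (fun _ : ℝ ↦ g') z 0 y) y‖ ≤ ε := by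
  intro M _ _ _ _ _ _ g cov T hT _ _ hbounds
  refine exists_scaledLimit_metric hT fun z ↦ ?_
  obtain ⟨r, t₁, lam, hr, ht₁, hlam, hball, hpos, -, hcauchy⟩ := hbounds z
  exact ⟨r, t₁, lam, hr, ht₁, hlam, hball, hpos, hcauchy⟩

end Literature.Geometry.Riemannian.HamiltonPinchedFlow

end Part6

/-!
## Part 7 — port of `Summits/SmoothPoincare4/SmoothPoincare4/Theorems/EntropyRungChangGurskyYangStubSmoothRoundLimitLimitRoundAux.lean` (14 declarations kept)

# The smooth chart-limit of the scaled metrics is round, I: curvature under `C²` convergence of metrics (O'Neill 1983, Lemma 3.38; Petersen 2006, Ch. 10, §3.2)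

Declarations of this Part (verbatim port; each keeps its own docstring and citation): `tendsto_riemAt`, `tendsto_ginv`, `tendsto_rmNormSqAt`, `tendsto_iteratedFDeriv_fderiv`, `tendsto_of_iteratedFDeriv_zero`, `jets_of_tendsto_iteratedFDeriv`, `exists_seq_tendsto`, `tendsto_const_sub_of_tendsto`, `eventually_le_of_tendsto`, `tendsto_scaled_curvNormSq`, `ricAt_chartRep_const_eq`, `chartRep_constSmul`, `curvNormSqWith_constSmul_eq`, `normSq_ricci_eq_one_of_ricci_eq_half`.

References: R. S. Hamilton, *Three-manifolds with positive Ricci curvature*, J. Differential Geom. 17 (1982) 255–306 [Hamilton1982]; A. L. Besse, *Einstein Manifolds*, Springer 1987 [Besse1987]; P. Petersen, *Riemannian Geometry*, 2nd ed., GTM 171, Springer 2006 [Petersen2006]; B. O'Neill, *Semi-Riemannian Geometry*, Academic Press 1983 [ONeill1983].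
-/

section Part7

-- operator spaces of bilinear forms over the model space
set_option maxSynthPendingDepth 3

open _root_.Set _root_.Function _root_.Filter _root_.Module _root_.Metric
open scoped _root_.Manifold _root_.ContDiff _root_.Topology

namespace Literature.Geometry.Riemannian.HamiltonPinchedFlow

open Literature.Geometry.Riemannian
open Literature.Geometry.Lorentzian Literature.Geometry.Lorentzian.PseudoRiemannianMetric
open Literature.Geometry.Lorentzian.MetricCoord

/-! ### Continuity of `R` and `|Rm|²` of metric components in the 2-jet -/

section CoordContinuity

variable {ι : Type*} {l : Filter ι} {E : Type*} [NormedAddCommGroup E] [NormedSpace ℝ E]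
  [CompleteSpace E] {Gs : ι → E → E →L[ℝ] E →L[ℝ] ℝ} {G : E → E →L[ℝ] E →L[ℝ] ℝ} {V : Set E}
  {x : E}

/-- **The curvature endomorphism `R(X,Y) ∈ End E` is continuous in the 2-jet** (operator-norm
version of `tendsto_riemAt_apply`: `R = DΓ − DΓ + Γ∘Γ − Γ∘Γ`). [cite: ONeill1983, Ch. 3, Lemma 3.38] -/
theorem tendsto_riemAt (hGs : ∀ i, IsMetricOn (Gs i) V) (hG : IsMetricOn G V) (hx : x ∈ V)
    (h0 : Tendsto (fun i ↦ Gs i x) l (𝓝 (G x)))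
    (h1 : Tendsto (fun i ↦ fderiv ℝ (Gs i) x) l (𝓝 (fderiv ℝ G x)))
    (h2 : Tendsto (fun i ↦ fderiv ℝ (fderiv ℝ (Gs i)) x) l (𝓝 (fderiv ℝ (fderiv ℝ G) x)))
    (X Y : E) :
    Tendsto (fun i ↦ riemAt (Gs i) x X Y) l (𝓝 (riemAt G x X Y)) := by
  have hDXY := tendsto_fderiv_chrAt_apply₂ hGs hG hx h0 h1 h2 X Y
  have hDYX := tendsto_fderiv_chrAt_apply₂ hGs hG hx h0 h1 h2 Y X
  have hΓX := tendsto_chrAt_apply hG hx h0 h1 X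
  have hΓY := tendsto_chrAt_apply hG hx h0 h1 Y
  have h := ((hDXY.sub hDYX).add (tendsto_clm_comp hΓX hΓY)).sub (tendsto_clm_comp hΓY hΓX)
  exact h

variable [FiniteDimensional ℝ E]

/-- **The inverse metric coefficients `g^{ij}` are continuous in the 0-jet**. [cite: Hamilton1982, §17, Cor. 17.11; Petersen 2006, Ch. 10, §3.2] -/
theorem tendsto_ginv {κ : Type*} [Fintype κ] (b : Basis κ ℝ E) (hG : IsMetricOn G V)
    (hx : x ∈ V) (h0 : Tendsto (fun i ↦ Gs i x) l (𝓝 (G x))) (a a' : κ) :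
    Tendsto (fun i ↦ ginv (Gs i) b x a a') l (𝓝 (ginv G b x a a')) := by
  unfold ginv
  exact ((b.coord a).continuous_of_finiteDimensional.tendsto _).comp
    (tendsto_clm_apply_const (tendsto_sharpAt hG hx h0) (coordCLM b a'))

/-- **`|Rm|²` of metric components is continuous in the 2-jet**: if the jets of `Gᵢ` converge to
the jet of `G` at `x`, then `|Rm[Gᵢ]|²(x) → |Rm[G]|²(x)` (the basis formula `rmNormSqAt_eq_sum`, a
polynomial in `g^{ij}` and the curvature endomorphisms). [cite: Petersen2006, Ch. 10, §3.2] -/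
theorem tendsto_rmNormSqAt (hGs : ∀ i, IsMetricOn (Gs i) V) (hG : IsMetricOn G V) (hx : x ∈ V)
    (h0 : Tendsto (fun i ↦ Gs i x) l (𝓝 (G x)))
    (h1 : Tendsto (fun i ↦ fderiv ℝ (Gs i) x) l (𝓝 (fderiv ℝ G x)))
    (h2 : Tendsto (fun i ↦ fderiv ℝ (fderiv ℝ (Gs i)) x) l (𝓝 (fderiv ℝ (fderiv ℝ G) x))) :
    Tendsto (fun i ↦ rmNormSqAt (Gs i) x) l (𝓝 (rmNormSqAt G x)) := by
  let b := Module.finBasis ℝ E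
  simp only [rmNormSqAt_eq_sum b]
  refine Tendsto.neg (tendsto_finsetSum _ fun a _ ↦ tendsto_finsetSum _ fun a' _ ↦
    tendsto_finsetSum _ fun c _ ↦ tendsto_finsetSum _ fun c' _ ↦ ?_)
  exact ((tendsto_ginv b hG hx h0 a a').mul (tendsto_ginv b hG hx h0 c c')).mul
    (((traceCLM E).continuous.tendsto _).comp
      (tendsto_clm_comp (tendsto_riemAt hGs hG hx h0 h1 h2 (b a) (b c))
        (tendsto_riemAt hGs hG hx h0 h1 h2 (b a') (b c'))))

end CoordContinuity

/-! ### Jets from the convergence of the iterated derivatives -/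

section Jets

variable {ι : Type*} {l : Filter ι} {P : Type*} [NormedAddCommGroup P] [NormedSpace ℝ P]
  {G : Type*} [NormedAddCommGroup G] [NormedSpace ℝ G] {F : ι → P → G} {F' : P → G} {x : P}

/-- If all iterated derivatives of `Fᵢ` converge to those of `F'` at `x`, the same holds for the
families of first derivatives (`D^m(Df) = curry (D^{m+1} f)`). [cite: Hamilton1982, §17, Cor. 17.11; Petersen 2006, Ch. 10, §3.2] -/
theorem tendsto_iteratedFDeriv_fderiv
    (h : ∀ m : ℕ, Tendsto (fun i ↦ iteratedFDeriv ℝ m (F i) x) l (𝓝 (iteratedFDeriv ℝ m F' x)))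
    (m : ℕ) :
    Tendsto (fun i ↦ iteratedFDeriv ℝ m (fderiv ℝ (F i)) x) l
      (𝓝 (iteratedFDeriv ℝ m (fderiv ℝ F') x)) := by
  have key : ∀ f : P → G, iteratedFDeriv ℝ m (fderiv ℝ f) x =
      continuousMultilinearCurryRightEquiv' ℝ m P G (iteratedFDeriv ℝ (m + 1) f x) := by
    intro f
    rw [iteratedFDeriv_succ_eq_comp_right, Function.comp_apply, LinearIsometryEquiv.apply_symm_apply]
  simp only [key]
  exact ((continuousMultilinearCurryRightEquiv' ℝ m P G).continuous.tendsto _).comp (h (m + 1))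

/-- Convergence of the `0`-th iterated derivatives is convergence of the values. [cite: Hamilton1982, §17, Cor. 17.11; Petersen 2006, Ch. 10, §3.2] -/
theorem tendsto_of_iteratedFDeriv_zero
    (h : Tendsto (fun i ↦ iteratedFDeriv ℝ 0 (F i) x) l (𝓝 (iteratedFDeriv ℝ 0 F' x))) :
    Tendsto (fun i ↦ F i x) l (𝓝 (F' x)) := by
  have := ((continuous_eval_const (0 : Fin 0 → P)).tendsto _).comp h
  exact this

/-- **The 2-jets converge** when all iterated derivatives converge at the point: values, first and
second derivatives. [cite: Hamilton1982, §17, Cor. 17.11; Petersen 2006, Ch. 10, §3.2] -/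
theorem jets_of_tendsto_iteratedFDeriv
    (h : ∀ m : ℕ, Tendsto (fun i ↦ iteratedFDeriv ℝ m (F i) x) l (𝓝 (iteratedFDeriv ℝ m F' x))) :
    Tendsto (fun i ↦ F i x) l (𝓝 (F' x)) ∧
    Tendsto (fun i ↦ fderiv ℝ (F i) x) l (𝓝 (fderiv ℝ F' x)) ∧
    Tendsto (fun i ↦ fderiv ℝ (fderiv ℝ (F i)) x) l (𝓝 (fderiv ℝ (fderiv ℝ F') x)) := by
  have h1 := tendsto_iteratedFDeriv_fderiv h
  have h2 := tendsto_iteratedFDeriv_fderiv (F := fun i ↦ fderiv ℝ (F i)) h1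
  exact ⟨tendsto_of_iteratedFDeriv_zero (h 0), tendsto_of_iteratedFDeriv_zero (h1 0),
    tendsto_of_iteratedFDeriv_zero (h2 0)⟩

end Jets

/-! ### The time sequence and the limits of the scaled roundness quantities -/

section Rates

/-- **A sequence of times `sₙ ↑ T` in `[0, T)`** (`sₙ = T − T/(n+2)`), along which the limits
`t ↑ T` are read. [cite: Hamilton1982, §17, Cor. 17.11; Petersen 2006, Ch. 10, §3.2] -/
theorem exists_seq_tendsto {T : ℝ} (hT : 0 < T) :
    ∃ s : ℕ → ℝ, (∀ n, s n ∈ Ico 0 T) ∧ Tendsto s atTop (𝓝 T) := by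
  refine ⟨fun n ↦ T - T / (n + 2), fun n ↦ ?_, ?_⟩
  · have hn : (0 : ℝ) < n + 2 := by positivity
    refine ⟨?_, ?_⟩
    · rw [sub_nonneg, div_le_iff₀ hn]
      nlinarith
    · rw [sub_lt_self_iff]
      exact div_pos hT hn
  · have h : Tendsto (fun n : ℕ ↦ T / ((n : ℝ) + 2)) atTop (𝓝 0) :=
      tendsto_const_nhds.div_atTop (tendsto_natCast_atTop_atTop.atTop_add tendsto_const_nhds)
    have := tendsto_const_nhds (x := T).sub h
    rw [sub_zero] at this
    exact this

/-- Along `sₙ → T`: `T − sₙ → 0`. [cite: Hamilton1982, §17, Cor. 17.11; Petersen 2006, Ch. 10, §3.2] -/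
theorem tendsto_const_sub_of_tendsto {s : ℕ → ℝ} {T : ℝ} (hs : Tendsto s atTop (𝓝 T)) :
    Tendsto (fun n ↦ T - s n) atTop (𝓝 0) := by
  have := tendsto_const_nhds (x := T).sub hs
  rw [sub_self] at this
  exact this

/-- Along `sₙ → T`: eventually `t₂ ≤ sₙ`, for every `t₂ < T`. [cite: Hamilton1982, §17, Cor. 17.11; Petersen 2006, Ch. 10, §3.2] -/
theorem eventually_le_of_tendsto {s : ℕ → ℝ} {T t₂ : ℝ} (hs : Tendsto s atTop (𝓝 T))
    (ht₂ : t₂ < T) : ∀ᶠ n in atTop, t₂ ≤ s n :=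
  ((tendsto_order.1 hs).1 t₂ ht₂).mono fun _ hn ↦ hn.le

/-- **The roundness rates force `h²|Rm|² → 2/3`**: if `hₙ → 0⁺`, `|hₙRₙ − 2| ≤ C hₙ^δ`,
`0 ≤ hₙ²(Nₙ − Rₙ²/4) ≤ C hₙ^{2δ}` and `0 ≤ hₙ²(Qₙ − 2Nₙ + Rₙ²/3) ≤ C hₙ^δ` eventually (`δ > 0`),
then `hₙ² Qₙ → 2/3` (`h²Q = h²|W|² + 2h²|E|² + (hR)²/6`). [cite: Hamilton1982, §17, Cor. 17.11] -/
theorem tendsto_scaled_curvNormSq {h R N Q : ℕ → ℝ} {C δ : ℝ} (hδ : 0 < δ)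
    (hh : Tendsto h atTop (𝓝 0))
    (h1 : ∀ᶠ n in atTop, |h n * R n - 2| ≤ C * h n ^ δ)
    (h2 : ∀ᶠ n in atTop, h n ^ 2 * (N n - R n ^ 2 / 4) ≤ C * h n ^ (2 * δ))
    (h3 : ∀ᶠ n in atTop, h n ^ 2 * (Q n - 2 * N n + R n ^ 2 / 3) ≤ C * h n ^ δ)
    (hE : ∀ᶠ n in atTop, 0 ≤ N n - R n ^ 2 / 4)
    (hW : ∀ᶠ n in atTop, 0 ≤ Q n - 2 * N n + R n ^ 2 / 3) :
    Tendsto (fun n ↦ h n ^ 2 * Q n) atTop (𝓝 (2 / 3)) := by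
  -- the rates tend to zero
  have hCδ : Tendsto (fun n ↦ C * h n ^ δ) atTop (𝓝 0) := by
    have := (hh.rpow_const (Or.inr hδ.le)).const_mul C
    rwa [Real.zero_rpow hδ.ne', mul_zero] at this
  have hC2δ : Tendsto (fun n ↦ C * h n ^ (2 * δ)) atTop (𝓝 0) := by
    have h2δ : 0 < 2 * δ := by positivity
    have := (hh.rpow_const (Or.inr h2δ.le)).const_mul C
    rwa [Real.zero_rpow h2δ.ne', mul_zero] at this
  -- `hR → 2`
  have hR : Tendsto (fun n ↦ h n * R n) atTop (𝓝 2) := by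
    have h0 : Tendsto (fun n ↦ h n * R n - 2) atTop (𝓝 0) :=
      squeeze_zero_norm' (h1.mono fun n hn ↦ by simpa [Real.norm_eq_abs] using hn) hCδ
    have := h0.add_const 2
    simpa using this
  -- `h²|E|² → 0`, `h²|W|² → 0`
  have hEt : Tendsto (fun n ↦ h n ^ 2 * (N n - R n ^ 2 / 4)) atTop (𝓝 0) :=
    tendsto_of_tendsto_of_tendsto_of_le_of_le' tendsto_const_nhds hC2δ
      (hE.mono fun n hn ↦ mul_nonneg (sq_nonneg _) hn) h2
  have hWt : Tendsto (fun n ↦ h n ^ 2 * (Q n - 2 * N n + R n ^ 2 / 3)) atTop (𝓝 0) :=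
    tendsto_of_tendsto_of_tendsto_of_le_of_le' tendsto_const_nhds hCδ
      (hW.mono fun n hn ↦ mul_nonneg (sq_nonneg _) hn) h3
  have key := (hWt.add (hEt.const_mul 2)).add ((hR.pow 2).div_const 6)
  have heq : ∀ n, h n ^ 2 * (Q n - 2 * N n + R n ^ 2 / 3) + 2 * (h n ^ 2 * (N n - R n ^ 2 / 4)) +
      (h n * R n) ^ 2 / 6 = h n ^ 2 * Q n := fun n ↦ by ring
  simp only [heq] at key
  norm_num at key
  exact key

end Rates

/-! ### The chart dictionary at a point, for a single metric and for the scaled metric -/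

section Dictionary

variable {M : Type*} [TopologicalSpace M] [ChartedSpace (EuclideanSpace ℝ (Fin 4)) M]
  [IsManifold (𝓡 4) ∞ M]

/-- **The coordinate Ricci form of a metric read in a chart is its Ricci tensor on the frame
vectors**: `Ric(chartRep g₁)(y)(v, w) = Ric_{cov₁}(Φ y)(dΦ v, dΦ w)` for any Levi-Civita witness
`cov₁` of `g₁` (naturality of `Ric` under the inverse chart `Φ`, `ricci_comap_apply`, and
`OpensChart.ricci_eq_ricAt`). [cite: Petersen2006, Ch. 10, §3.2] -/
theorem ricAt_chartRep_const_eq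
    (g₁ : PseudoRiemannianMetric (𝓡 4) ∞ (EuclideanSpace ℝ (Fin 4)) (TangentSpace (𝓡 4) : M → Type _))
    {cov₁ : CovariantDerivative (𝓡 4) (EuclideanSpace ℝ (Fin 4)) (TangentSpace (𝓡 4) : M → Type _)}
    (hLC : g₁.IsLeviCivita cov₁) (z : M) (y : chartTarget (𝓡 4) z) (v w : EuclideanSpace ℝ (Fin 4)) :
    ricAt (chartRep (𝓡 4) (fun _ ↦ g₁) z 0) y v w =
      cov₁.ricci (chartInv (𝓡 4) z y)
        (mfderiv 𝓘(ℝ, EuclideanSpace ℝ (Fin 4)) (𝓡 4) (chartInv (𝓡 4) z) y v)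
        (mfderiv 𝓘(ℝ, EuclideanSpace ℝ (Fin 4)) (𝓡 4) (chartInv (𝓡 4) z) y w) := by
  haveI := g₁.hasLeviCivita
  haveI := (chartPullback (𝓡 4) g₁ z).hasLeviCivita
  have h2 : (2 : ℕ∞ω) ≤ ∞ := WithTop.coe_le_coe.mpr le_top
  rw [hLC.ricci_eq_ricci h2,
    ← OpensChart.ricci_eq_ricAt (val_chartPullback_eq_chartRep (fun _ ↦ g₁) z 0) y v w,
    g₁.ricci_comap_apply contMDiff_pullbackBilin_holds (contMDiff_chartInv z)
      (injective_mfderiv_chartInv z) rfl y v w]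

variable {g : ℝ → PseudoRiemannianMetric (𝓡 4) ∞ (EuclideanSpace ℝ (Fin 4)) (TangentSpace (𝓡 4) : M → Type _)}
  {cov : ℝ → CovariantDerivative (𝓡 4) (EuclideanSpace ℝ (Fin 4)) (TangentSpace (𝓡 4) : M → Type _)}
  {T : ℝ}

/-- **The chart representative of the scaled metric `c g(t)` is `c` times that of `g(t)`**
(`chartRep` is linear in the coefficients). [cite: Hamilton1982, §17, Cor. 17.11; Petersen 2006, Ch. 10, §3.2] -/
theorem chartRep_constSmul (z : M) (t c : ℝ) (hc : c ≠ 0) :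
    chartRep (𝓡 4) (fun _ ↦ (g t).constSmul c hc) z 0 =
      fun y ↦ c • chartRep (𝓡 4) g z t y := by
  funext y
  ext v w
  simp only [chartRep, gramOpFamily, ContinuousLinearMap.bilinearComp_apply, _root_.smul_apply,
    smul_eq_mul]
  exact constSmul_apply _ _ _ _ _ _

/-- `|Rm|²` under homothety: `|Rm|²_{c g} = c⁻² |Rm|²_g` (same connection; the traces scale by
`c⁻¹` each, `trace_constSmul`). [cite: Hamilton1982, §17, Cor. 17.11] -/
theorem curvNormSqWith_constSmul_eq
    (g₁ : PseudoRiemannianMetric (𝓡 4) ∞ (EuclideanSpace ℝ (Fin 4)) (TangentSpace (𝓡 4) : M → Type _))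
    (cov₁ : CovariantDerivative (𝓡 4) (EuclideanSpace ℝ (Fin 4)) (TangentSpace (𝓡 4) : M → Type _))
    (c : ℝ) (hc : c ≠ 0) (x : M) :
    (g₁.constSmul c hc).curvNormSqWith cov₁ x = c⁻¹ ^ 2 * g₁.curvNormSqWith cov₁ x := by
  have hinner : (g₁.constSmul c hc).curvInnerForm cov₁ x = c⁻¹ • g₁.curvInnerForm cov₁ x := by
    ext X X'
    rw [curvInnerForm_apply, LinearMap.smul_apply, LinearMap.smul_apply, curvInnerForm_apply,
      trace_constSmul, smul_eq_mul]
  rw [curvNormSqWith, curvNormSqWith, hinner, trace_smul', trace_constSmul]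
  ring

/-- **`|Ric|² = 1` for `Ric = g/2` in dimension four** (`Σ_{ab} (δ_{ab}/2)² = 1` in an
orthonormal basis, `ricciNormSqFrame_eq_normSq`). [cite: Besse1987, 1.118] -/
theorem normSq_ricci_eq_one_of_ricci_eq_half
    (g' : PseudoRiemannianMetric (𝓡 4) ∞ (EuclideanSpace ℝ (Fin 4)) (TangentSpace (𝓡 4) : M → Type _))
    [g'.HasLeviCivita] (hg' : g'.IsRiemannian)
    (hRic : ∀ (x : M) (X Y : TangentSpace (𝓡 4) x), g'.ricci x X Y = 1 / 2 * g'.val x X Y)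
    (x : M) : g'.normSq x (g'.ricci x) = 1 := by
  classical
  obtain ⟨b, hb⟩ := g'.exists_basis_isOrthonormalFrame (hg' x) finrank_euclideanFour
  rw [← g'.ricciNormSqFrame_eq_normSq hb (by rw [Fintype.card_fin, finrank_euclideanFour]),
    ricciNormSqFrame]
  have hδ : ∀ a c : Fin 4, g'.val x (b a) (b c) = if a = c then 1 else 0 := by
    intro a c
    by_cases hac : a = c
    · subst hac; simp [hb.1 a]
    · simp [hac, hb.2 a c hac]
  simp only [hRic, hδ]
  simp
  norm_num

end Dictionary

/-! ### Main statement -/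

end Literature.Geometry.Riemannian.HamiltonPinchedFlow

end Part7

/-!
## Part 8 — port of `Summits/SmoothPoincare4/SmoothPoincare4/Theorems/EntropyRungChangGurskyYangStubSmoothRoundLimitLimitRound.lean` (2 declarations kept)

# The smooth chart-limit of the scaled metrics is round, II: `Ric(g') = g'/2`, `W(g') = 0`, constant sectional curvature (Hamilton 1982, Cor. 17.11)

Declarations of this Part (verbatim port; each keeps its own docstring and citation): `scaledLimit_ricci_and_curvNormSq`, `helper_scaledLimit_round`.

References: R. S. Hamilton, *Three-manifolds with positive Ricci curvature*, J. Differential Geom. 17 (1982) 255–306 [Hamilton1982]; A. L. Besse, *Einstein Manifolds*, Springer 1987 [Besse1987]; P. Petersen, *Riemannian Geometry*, 2nd ed., GTM 171, Springer 2006 [Petersen2006].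
-/

section Part8

-- operator spaces of bilinear forms over the model space
set_option maxSynthPendingDepth 3

open _root_.Set _root_.Function _root_.Filter _root_.Module _root_.Metric
open scoped _root_.Manifold _root_.ContDiff _root_.Topology

namespace Literature.Geometry.Riemannian.HamiltonPinchedFlow

open Literature.Geometry.Riemannian
open Literature.Geometry.Lorentzian Literature.Geometry.Lorentzian.PseudoRiemannianMetric
open Literature.Geometry.Lorentzian.MetricCoord

/-! ### The limit metric at a point: `Ric(g') = g'/2` and `|Rm(g')|² = 2/3` -/

section Pointwise

variable {M : Type*} [TopologicalSpace M] [ChartedSpace (EuclideanSpace ℝ (Fin 4)) M]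
  [IsManifold (𝓡 4) ∞ M]
  {g : ℝ → PseudoRiemannianMetric (𝓡 4) ∞ (EuclideanSpace ℝ (Fin 4)) (TangentSpace (𝓡 4) : M → Type _)}
  {cov : ℝ → CovariantDerivative (𝓡 4) (EuclideanSpace ℝ (Fin 4)) (TangentSpace (𝓡 4) : M → Type _)}
  {T δ C t₀ : ℝ}

/-- **The smooth chart-limit of `g(t)/(T−t)` is Einstein with `|Rm|² = 2/3` at every point**
(Hamilton 1982, §17, Cor. 17.11, through Petersen's "curvature passes to `C²` limits of the metric
components", 2006, Ch. 10, §3.2). At the centre `ẑ` of the chart at `z`, along `tₙ ↑ T`: the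
2-jets of the scaled representatives `G̃ₙ` converge to the 2-jet of the representative `G'` of
`g'` (`jets_of_tendsto_iteratedFDeriv`); `Ric(G̃ₙ)(ẑ) − G̃ₙ(ẑ)/2 → 0` in operator norm
(`norm_ricAt_sub_smul_chartRep_le`, scale invariance of `Ric`) while
`Ric(G̃ₙ)(ẑ) → Ric(G')(ẑ)` (`tendsto_ricAt_apply`), so `Ric(G')(ẑ) = G'(ẑ)/2`, i.e.
`Ric(g')(z) = g'(z)/2` (`ricAt_chartRep_const_eq`, `dΦ` invertible); and
`|Rm(G̃ₙ)|²(ẑ) = (T−tₙ)²|Rm(g(tₙ))|²(z) → 2/3` by the roundness rates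
(`tendsto_scaled_curvNormSq`) while `|Rm(G̃ₙ)|²(ẑ) → |Rm(G')|²(ẑ)` (`tendsto_rmNormSqAt`), so
`|Rm(g')|²(z) = 2/3` (`curvNormSqWith_chartInv_eq'`). [cite: Hamilton1982, §17, Cor. 17.11]
[cite: Petersen2006, Ch. 10, §3.2] -/
theorem scaledLimit_ricci_and_curvNormSq (hT : 0 < T) (hflow : IsRicciFlow g cov (Ico 0 T))
    (hRiem : ∀ t ∈ Ico 0 T, (g t).IsRiemannian) (hδ : 0 < δ) (ht₀ : t₀ ∈ Ico 0 T)
    (hrate : ∀ t ∈ Ico t₀ T, ∀ x : M,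
      |(T - t) * (g t).scalarCurvatureWith (cov t) x - 2| ≤ C * (T - t) ^ δ ∧
      (T - t) ^ 2 * ((g t).normSq x ((cov t).ricci x) -
        (g t).scalarCurvatureWith (cov t) x ^ 2 / 4) ≤ C * (T - t) ^ (2 * δ) ∧
      (T - t) ^ 2 * ((g t).curvNormSqWith (cov t) x - 2 * (g t).normSq x ((cov t).ricci x) +
        (g t).scalarCurvatureWith (cov t) x ^ 2 / 3) ≤ C * (T - t) ^ δ)
    (g' : PseudoRiemannianMetric (𝓡 4) ∞ (EuclideanSpace ℝ (Fin 4)) (TangentSpace (𝓡 4) : M → Type _))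
    [g'.HasLeviCivita] (z : M) {r : ℝ} (hr : 0 < r)
    (hcl : closedBall (extChartAt (𝓡 4) z z) r ⊆ (extChartAt (𝓡 4) z).target)
    (hcv : ∀ m : ℕ, ∀ ε : ℝ, 0 < ε → ∃ t₂ ∈ Ico 0 T, ∀ t ∈ Ico t₂ T,
      ∀ y ∈ ball (extChartAt (𝓡 4) z z) r,
        ‖iteratedFDeriv ℝ m (fun y : EuclideanSpace ℝ (Fin 4) ↦ (T - t)⁻¹ • chartRep (𝓡 4) g z t y) y -
          iteratedFDeriv ℝ m (fun y : EuclideanSpace ℝ (Fin 4) ↦ chartRep (𝓡 4) (fun _ : ℝ ↦ g') z 0 y) y‖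
          ≤ ε) :
    (∀ X Y : TangentSpace (𝓡 4) z, g'.ricci z X Y = 1 / 2 * g'.val z X Y) ∧
      g'.curvNormSqWith g'.leviCivita z = 2 / 3 := by
  have hrate2 : ∀ t ∈ Ico t₀ T, ∀ x : M,
      |(T - t) * (g t).scalarCurvatureWith (cov t) x - 2| ≤ C * (T - t) ^ δ ∧
      (T - t) ^ 2 * ((g t).normSq x ((cov t).ricci x) -
        (g t).scalarCurvatureWith (cov t) x ^ 2 / 4) ≤ C * (T - t) ^ (2 * δ) :=
    fun t ht x ↦ ⟨(hrate t ht x).1, (hrate t ht x).2.1⟩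
  -- the centre of the chart
  set y₀ : EuclideanSpace ℝ (Fin 4) := extChartAt (𝓡 4) z z with hy₀def
  have hy₀t : y₀ ∈ (extChartAt (𝓡 4) z).target := mem_extChartAt_target z
  have hy₀b : y₀ ∈ ball y₀ r := mem_ball_self hr
  have hy₀c : y₀ ∈ closedBall y₀ r := mem_closedBall_self hr.le
  set u₀ : chartTarget (𝓡 4) z := ⟨y₀, hy₀t⟩ with hu₀def
  have hu₀ : chartInv (𝓡 4) z u₀ = z := extChartAt_to_inv z
  set L := mfderiv 𝓘(ℝ, EuclideanSpace ℝ (Fin 4)) (𝓡 4) (chartInv (𝓡 4) z) u₀ with hL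
  have hLi : L.IsInvertible :=
    isInvertible_mfderiv_of_injective rfl (injective_mfderiv_chartInv z u₀)
  -- two-sided bounds of the scaled representative on the closed ball
  obtain ⟨lam, Λ, -, hbd⟩ := scaledChartRep_twoSided hflow hRiem hδ ht₀ hrate2 z hr.le hcl
  -- the time sequence and the scaled metrics
  obtain ⟨s, ht, hsT⟩ := exists_seq_tendsto hT
  have hTt : ∀ n, 0 < T - s n := fun n ↦ sub_pos.2 (ht n).2
  set gs : ℕ → PseudoRiemannianMetric (𝓡 4) ∞ (EuclideanSpace ℝ (Fin 4)) (TangentSpace (𝓡 4) : M → Type _) :=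
    fun n ↦ (g (s n)).constSmul (T - s n)⁻¹ (inv_ne_zero (hTt n).ne') with hgs
  have hLCs : ∀ n, (gs n).IsLeviCivita (cov (s n)) := fun n ↦
    (hflow.isLeviCivita (s n) (ht n)).constSmul _ _
  set Gs : ℕ → EuclideanSpace ℝ (Fin 4) → EuclideanSpace ℝ (Fin 4) →L[ℝ] EuclideanSpace ℝ (Fin 4) →L[ℝ] ℝ :=
    fun n ↦ chartRep (𝓡 4) (fun _ ↦ gs n) z 0 with hGs
  set G' : EuclideanSpace ℝ (Fin 4) → EuclideanSpace ℝ (Fin 4) →L[ℝ] EuclideanSpace ℝ (Fin 4) →L[ℝ] ℝ :=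
    chartRep (𝓡 4) (fun _ ↦ g') z 0 with hG'
  have hGs_eq : ∀ n, (fun y : EuclideanSpace ℝ (Fin 4) ↦
      (T - s n)⁻¹ • chartRep (𝓡 4) g z (s n) y) = Gs n :=
    fun n ↦ (chartRep_constSmul z (s n) _ _).symm
  have hGsm : ∀ n, IsMetricOn (Gs n) (extChartAt (𝓡 4) z).target := fun n ↦
    isMetricOn_chartRep_const (gs n) z
  have hG'm : IsMetricOn G' (extChartAt (𝓡 4) z).target := isMetricOn_chartRep_const g' z
  -- the jets converge at the centre along the sequence
  have hjet : ∀ m : ℕ, Tendsto (fun n ↦ iteratedFDeriv ℝ m (Gs n) y₀) atTop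
      (𝓝 (iteratedFDeriv ℝ m G' y₀)) := by
    intro m
    rw [Metric.tendsto_nhds]
    intro ε hε
    obtain ⟨t₂, ht₂, hb⟩ := hcv m (ε / 2) (half_pos hε)
    filter_upwards [eventually_le_of_tendsto hsT ht₂.2] with n hn
    have h := hb (s n) ⟨hn, (ht n).2⟩ y₀ hy₀b
    rw [hGs_eq n] at h
    rw [dist_eq_norm]
    exact lt_of_le_of_lt h (half_lt_self hε)
  obtain ⟨hj0, hj1, hj2⟩ := jets_of_tendsto_iteratedFDeriv hjet
  constructor
  · -- (A) `Ric(G')(ẑ) = G'(ẑ)/2`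
    have hchart : ∀ v w : EuclideanSpace ℝ (Fin 4), ricAt G' y₀ v w = 1 / 2 * G' y₀ v w := by
      intro v w
      have hlim1 : Tendsto (fun n ↦ ricAt (Gs n) y₀ v w - 1 / 2 * Gs n y₀ v w) atTop
          (𝓝 (ricAt G' y₀ v w - 1 / 2 * G' y₀ v w)) :=
        (tendsto_ricAt_apply hGsm hG'm hy₀t hj0 hj1 hj2 v w).sub
          ((tendsto_clm_apply_const (tendsto_clm_apply_const hj0 v) w).const_mul _)
      have hlim0 : Tendsto (fun n ↦ ricAt (Gs n) y₀ v w - 1 / 2 * Gs n y₀ v w) atTop (𝓝 0) := by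
        have hb0 : Tendsto (fun n ↦ Real.sqrt (C ^ 2 + 4 * C) * Λ * (T - s n) ^ δ *
            ‖v‖ * ‖w‖) atTop (𝓝 0) := by
          have h := ((((tendsto_const_sub_of_tendsto hsT).rpow_const (Or.inr hδ.le)).const_mul
            (Real.sqrt (C ^ 2 + 4 * C) * Λ)).mul_const ‖v‖).mul_const ‖w‖
          rw [Real.zero_rpow hδ.ne', mul_zero, zero_mul, zero_mul] at h
          exact h
        refine squeeze_zero_norm' ?_ hb0
        filter_upwards [eventually_le_of_tendsto hsT ht₀.2] with n hn
        have htn : s n ∈ Ico t₀ T := ⟨hn, (ht n).2⟩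
        have hΛ := (hbd (s n) htn y₀ hy₀c).2
        have hnorm := norm_ricAt_sub_smul_chartRep_le hflow hRiem ht₀ hrate2 z hy₀t htn hΛ
        have e1 : ricAt (Gs n) y₀ v w = ricAt (chartRep (𝓡 4) g z (s n)) y₀ v w :=
          (ricAt_chartRep_const_eq (gs n) (hLCs n) z u₀ v w).trans
            (ricAt_chartRep_const_eq (g (s n)) (hflow.isLeviCivita _ (ht n)) z u₀ v w).symm
        have e2 : Gs n y₀ v w = (T - s n)⁻¹ * chartRep (𝓡 4) g z (s n) y₀ v w := by
          rw [← hGs_eq n]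
          rfl
        rw [e1, e2, Real.norm_eq_abs]
        have hTn := hTt n
        calc |ricAt (chartRep (𝓡 4) g z (s n)) y₀ v w -
              1 / 2 * ((T - s n)⁻¹ * chartRep (𝓡 4) g z (s n) y₀ v w)|
            = |(ricAt (chartRep (𝓡 4) g z (s n)) y₀ -
                (2 * (T - s n))⁻¹ • chartRep (𝓡 4) g z (s n) y₀) v w| := by
              congr 1
              simp only [_root_.sub_apply, _root_.smul_apply, smul_eq_mul, mul_inv]
              ring
          _ ≤ ‖ricAt (chartRep (𝓡 4) g z (s n)) y₀ -
                (2 * (T - s n))⁻¹ • chartRep (𝓡 4) g z (s n) y₀‖ * ‖v‖ * ‖w‖ :=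
              abs_apply₂_le _ v w
          _ ≤ Real.sqrt (C ^ 2 + 4 * C) * Λ * (T - s n) ^ δ * ‖v‖ * ‖w‖ := by
              gcongr
      have := tendsto_nhds_unique hlim1 hlim0
      linarith
    -- back on the manifold, at the point `Φ(ẑ) = z`
    have key : ∀ X Y : TangentSpace (𝓡 4) (chartInv (𝓡 4) z u₀),
        g'.ricci (chartInv (𝓡 4) z u₀) X Y = 1 / 2 * g'.val (chartInv (𝓡 4) z u₀) X Y := by
      intro X Y
      have h := hchart (L.inverse X) (L.inverse Y)
      have hric := ricAt_chartRep_const_eq g' g'.isLeviCivita_leviCivita_holds z u₀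
        (L.inverse X) (L.inverse Y)
      rw [← hL, hLi.self_apply_inverse, hLi.self_apply_inverse] at hric
      have hval : G' y₀ (L.inverse X) (L.inverse Y) = g'.val (chartInv (𝓡 4) z u₀) X Y := by
        rw [hG', chartRep_apply (fun _ ↦ g') z 0 u₀, val_chartPullback_apply, ← hL,
          hLi.self_apply_inverse, hLi.self_apply_inverse]
      rw [hval] at h
      rw [← h]
      exact hric.symm
    rw [hu₀] at key
    exact key
  · -- (B) `|Rm(G')|²(ẑ) = 2/3`
    have hlim1 := tendsto_rmNormSqAt hGsm hG'm hy₀t hj0 hj1 hj2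
    have hid : ∀ n, rmNormSqAt (Gs n) y₀ =
        (T - s n) ^ 2 * (g (s n)).curvNormSqWith (cov (s n)) z := by
      intro n
      have h := curvNormSqWith_chartInv_eq' (hLCs n) z u₀
      rw [hu₀] at h
      calc rmNormSqAt (Gs n) y₀ = (gs n).curvNormSqWith (cov (s n)) z := h.symm
        _ = (T - s n)⁻¹⁻¹ ^ 2 * (g (s n)).curvNormSqWith (cov (s n)) z :=
            curvNormSqWith_constSmul_eq _ _ _ _ z
        _ = (T - s n) ^ 2 * (g (s n)).curvNormSqWith (cov (s n)) z := by
            rw [inv_inv]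
    have hlim2 : Tendsto (fun n ↦ rmNormSqAt (Gs n) y₀) atTop (𝓝 (2 / 3)) := by
      rw [show (fun n ↦ rmNormSqAt (Gs n) y₀) =
          fun n ↦ (T - s n) ^ 2 * (g (s n)).curvNormSqWith (cov (s n)) z from funext hid]
      refine tendsto_scaled_curvNormSq
        (R := fun n ↦ (g (s n)).scalarCurvatureWith (cov (s n)) z)
        (N := fun n ↦ (g (s n)).normSq z ((cov (s n)).ricci z)) (C := C) hδ
        (tendsto_const_sub_of_tendsto hsT) ?_ ?_ ?_ ?_ ?_
      · filter_upwards [eventually_le_of_tendsto hsT ht₀.2] with n hn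
        exact (hrate _ ⟨hn, (ht n).2⟩ z).1
      · filter_upwards [eventually_le_of_tendsto hsT ht₀.2] with n hn
        exact (hrate _ ⟨hn, (ht n).2⟩ z).2.1
      · filter_upwards [eventually_le_of_tendsto hsT ht₀.2] with n hn
        exact (hrate _ ⟨hn, (ht n).2⟩ z).2.2
      · exact Eventually.of_forall fun n ↦ (traceless_weyl_nonneg hflow hRiem (ht n) z).1
      · exact Eventually.of_forall fun n ↦ (traceless_weyl_nonneg hflow hRiem (ht n) z).2
    have hRm : rmNormSqAt G' y₀ = 2 / 3 := tendsto_nhds_unique hlim1 hlim2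
    have h := curvNormSqWith_chartInv_eq' (g := g') g'.isLeviCivita_leviCivita_holds z u₀
    rw [hu₀] at h
    rw [h]
    exact hRm

end Pointwise

/-! ### Main statement -/

/-- **HELPER `helper_scaledLimit_round` — ANY SMOOTH CHART-LIMIT OF `g(t)/(T−t)` UNDER THE
ROUNDNESS RATES IS ROUND** (layer S5b of `stub_smoothRoundLimit`; Hamilton 1982, §17,
Cor. 17.11: the limit metric is Einstein, `Ric(g') = g'/2`, with vanishing Weyl tensor, hence of
constant sectional curvature `1/6` by the decomposition of the curvature tensor, Besse 1987,
1.114–1.118; curvature passes to `C²` limits of the metric components, Petersen 2006, Ch. 10,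
§3.2). Along a Ricci flow of Riemannian metrics on `[0, T)` on a closed `4`-manifold with
`|(T−t)R − 2| ≤ C(T−t)^δ`, `(T−t)²(|Ric|² − R²/4) ≤ C(T−t)^{2δ}`,
`(T−t)²(|Rm|² − 2|Ric|² + R²/3) ≤ C(T−t)^δ` on `[t₀, T)`, every Riemannian `C^∞` metric `g'`
whose chart representatives are `C^∞`-limits of the scaled representatives on chart balls has
constant sectional curvature `1/6`: pointwise `Ric(g') = g'/2` and `|Rm(g')|² = 2/3`
(`scaledLimit_ricci_and_curvNormSq`), so `R = 2`, `|Ric|² = 1`, `|W|² = |Rm|² − 2|Ric|² + R²/3 = 0`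
(`weylNormSq_eq_curvNormSqWith`), all frame Weyl components vanish
(`weylFrame_eq_zero_of_weylNormSq_eq_zero`), and
`hasConstantSectionalCurvature_of_ricci_eq_of_weylFrame_eq_zero` concludes.
[cite: Hamilton1982, §17, Cor. 17.11] [cite: Besse1987, 1.118] [cite: Petersen2006, Ch. 10, §3.2] -/
theorem helper_scaledLimit_round : ∀ (M : Type) [TopologicalSpace M] [T2Space M] [SecondCountableTopology M] [ChartedSpace (EuclideanSpace ℝ (Fin 4)) M] [IsManifold (𝓡 4) ∞ M] [CompactSpace M] (g : ℝ → PseudoRiemannianMetric (𝓡 4) ∞ (EuclideanSpace ℝ (Fin 4)) (TangentSpace (𝓡 4) : M → Type _)) (cov : ℝ → CovariantDerivative (𝓡 4) (EuclideanSpace ℝ (Fin 4)) (TangentSpace (𝓡 4) : M → Type _)) (T : ℝ), 0 < T → IsRicciFlow g cov (Ico 0 T) → (∀ t ∈ Ico 0 T, (g t).IsRiemannian) → ∀ (δ C t₀ : ℝ), 0 < δ → t₀ ∈ Ico 0 T → (∀ t ∈ Ico t₀ T, ∀ x : M, |(T - t) * (g t).scalarCurvatureWith (cov t) x - 2| ≤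 C * (T - t) ^ δ ∧ (T - t) ^ 2 * ((g t).normSq x ((cov t).ricci x) - (g t).scalarCurvatureWith (cov t) x ^ 2 / 4) ≤ C * (T - t) ^ (2 * δ) ∧ (T - t) ^ 2 * ((g t).curvNormSqWith (cov t) x - 2 * (g t).normSq x ((cov t).ricci x) + (g t).scalarCurvatureWith (cov t) x ^ 2 / 3) ≤ C * (T - t) ^ δ) → ∀ g' : PseudoRiemannianMetric (𝓡 4) ∞ (EuclideanSpace ℝ (Fin 4)) (TangentSpace (𝓡 4) : M → Type _), g'.IsRiemannian → (∀ z : M, ∃ r : ℝ, 0 < r ∧ Metric.closedBall (extChartAt (𝓡 4) z z) r ⊆ (extChartAt (𝓡 4) z).target ∧ ∀ m : ℕ, ∀ ε : ℝ, 0 < ε → ∃ t₂ ∈ Ico 0 T, ∀ t ∈ Ico t₂ T, ∀ y ∈ Metric.ball (extChartAt (𝓡 4) z z) r, ‖iteratedFDeriv ℝ m (fun y : EuclideanSpace ℝ (Fin 4) ↦ (T - t)⁻¹ • chartRep (𝓡 4) g z t y) y - iteratedFDeriv ℝ m (fun y : EuclideanSpace ℝ (Fin 4) ↦ chartRep (𝓡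 4) (fun _ : ℝ ↦ g') z 0 y) y‖ ≤ ε) → g'.HasConstantSectionalCurvature (1 / 6) := by
  intro M _ _ _ _ _ _ g cov T hT hflow hRiem δ C t₀ hδ ht₀ hrate g' hg' hconv
  haveI := g'.hasLeviCivita
  have h2 : (2 : ℕ∞ω) ≤ ∞ := WithTop.coe_le_coe.mpr le_top
  have key : ∀ z : M, (∀ X Y : TangentSpace (𝓡 4) z, g'.ricci z X Y = 1 / 2 * g'.val z X Y) ∧
      g'.curvNormSqWith g'.leviCivita z = 2 / 3 := by
    intro z
    obtain ⟨r, hr, hcl, hcv⟩ := hconv z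
    exact scaledLimit_ricci_and_curvNormSq hT hflow hRiem hδ ht₀ hrate g' z hr hcl hcv
  have hRic : ∀ (x : M) (X Y : TangentSpace (𝓡 4) x), g'.ricci x X Y = 1 / 2 * g'.val x X Y :=
    fun x ↦ (key x).1
  have hS : ∀ x : M, g'.scalarCurvature x = 2 := fun x ↦ by
    have h := scalarCurvature_eq_of_ricci_eq g' hg' finrank_euclideanFour hRic x
    norm_num at h
    exact h
  have hN : ∀ x : M, g'.normSq x (g'.ricci x) = 1 :=
    normSq_ricci_eq_one_of_ricci_eq_half g' hg' hRic
  have hW : ∀ (x : M) (e : Fin 4 → TangentSpace (𝓡 4) x), g'.IsOrthonormalFrame x e →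
      ∀ i j k l, g'.weylFrame x e i j k l = 0 := by
    intro x e he i j k l
    refine weylFrame_eq_zero_of_weylNormSq_eq_zero g' ?_ he i j k l
    rw [g'.weylNormSq_eq_curvNormSqWith hg' finrank_euclideanFour x, (key x).2, hN x, hS x]
    norm_num
  have h := hasConstantSectionalCurvature_of_ricci_eq_of_weylFrame_eq_zero g' h2 hg'
    finrank_euclideanFour hRic hW
  norm_num at h
  exact h

end Literature.Geometry.Riemannian.HamiltonPinchedFlow

end Part8

/-!
## Part 9 — port of `Summits/SmoothPoincare4/SmoothPoincare4/Theorems/EntropyRungChangGurskyYangStubSmoothRoundLimit.lean` (1 declarations kept)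

# The scaled metrics `g(t)/(T−t)` of a Type-I roundening Ricci flow converge smoothly to a round metric (Hamilton 1982, Lemma 14.2, Thm. 17.6, Cor. 17.10–17.11)

Declarations of this Part (verbatim port; each keeps its own docstring and citation): `stub_smoothRoundLimit`.

References: R. S. Hamilton, *Three-manifolds with positive Ricci curvature*, J. Differential Geom. 17 (1982) 255–306 [Hamilton1982]; A. L. Besse, *Einstein Manifolds*, Springer 1987 [Besse1987]; P. Topping, *Lectures on the Ricci flow*, LMS Lecture Note Series 325, CUP 2006 [Topping2006].
-/

section Part9

open _root_.Set _root_.Function _root_.Filter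
open scoped _root_.Manifold _root_.ContDiff _root_.Topology

namespace Literature.Geometry.Riemannian.HamiltonPinchedFlow

open Literature.Geometry.Riemannian
open Literature.Geometry.Lorentzian Literature.Geometry.Lorentzian.PseudoRiemannianMetric

/-- **THE SCALED METRICS `g(t)/(T−t)` CONVERGE SMOOTHLY TO A ROUND METRIC (Hamilton 1982,
§14, Lemma 14.2 and §17, Thm. 17.6–Cor. 17.11; Besse 1987, 1.118).** A Ricci flow of Riemannian metrics on
`[0, T)` on a closed connected 4-manifold with the roundness rate `|(T−t)R − 2| ≤ C(T−t)^δ`,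
`(T−t)²|E|² ≤ C(T−t)^{2δ}`, `(T−t)²|W|² ≤ C(T−t)^δ` and scaled Shi bounds of all orders carries a
`C^∞` Riemannian metric of constant sectional curvature (`1/6`). Assembly of the layers S2–S5; the
connectedness hypothesis of the statement is not used. [cite: Hamilton1982, §14, Lemma 14.2; §17, Thm. 17.6, Cor. 17.10, Cor. 17.11] [cite: Besse1987, 1.118] -/
theorem stub_smoothRoundLimit : ∀ (M : Type) [TopologicalSpace M] [T2Space M] [SecondCountableTopology M] [ChartedSpace (EuclideanSpace ℝ (Fin 4)) M] [IsManifold (𝓡 4) ∞ M] [CompactSpace M] [ConnectedSpace M] (g : ℝ → PseudoRiemannianMetric (𝓡 4) ∞ (EuclideanSpace ℝ (Fin 4)) (TangentSpace (𝓡 4) : M → Type _)) (cov : ℝ → CovariantDerivative (𝓡 4) (EuclideanSpace ℝ (Fin 4)) (TangentSpace (𝓡 4) : M → Type _)) (T : ℝ), 0 < T → IsRicciFlow g cov (Ico 0 T) → (∀ t ∈ Ico 0 T, (g t).IsRiemannian) → ∀ (δ C t₀ : ℝ), 0 < δ → t₀ ∈ Ico 0 T → (∀ t ∈ Ico t₀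 T, ∀ x : M, |(T - t) * (g t).scalarCurvatureWith (cov t) x - 2| ≤ C * (T - t) ^ δ ∧ (T - t) ^ 2 * ((g t).normSq x ((cov t).ricci x) - (g t).scalarCurvatureWith (cov t) x ^ 2 / 4) ≤ C * (T - t) ^ (2 * δ) ∧ (T - t) ^ 2 * ((g t).curvNormSqWith (cov t) x - 2 * (g t).normSq x ((cov t).ricci x) + (g t).scalarCurvatureWith (cov t) x ^ 2 / 3) ≤ C * (T - t) ^ δ) → (∀ k : ℕ, ∃ C' t₁ : ℝ, t₁ ∈ Ico 0 T ∧ ∀ t ∈ Ico t₁ T, ∀ z : M, curvDerivNormSq (𝓡 4) g k t z ≤ C' * ((T - t) ^ (k + 2))⁻¹) → ∃ (k : ℝ) (g' : PseudoRiemannianMetric (𝓡 4) ∞ (EuclideanSpace ℝ (Fin 4)) (TangentSpace (𝓡 4) : M → Type _)), 0 < k ∧ g'.IsRiemannian ∧ g'.HasConstantSectionalCurvature k := by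
  intro M _ _ _ _ _ _ _ g cov T hT hflow hRiem δ C t₀ hδ ht₀ hrate hshi
  have hP := helper_roundDefect_evolution M g cov T hT hflow hRiem
  have hW := fun θ f F Φf ΦF hθ ↦ helper_bernsteinWindow M g T θ f F Φf ΦF hT hθ hRiem
  have h1 := helper_curvDeriv_decay_one M g cov T hT hflow hRiem δ C t₀ hδ ht₀ hrate hshi hP hW
  have hdec := helper_curvDeriv_decay_all M g cov T hT hflow hRiem δ C t₀ hδ ht₀ hrate hshi hW h1
  have hdata := helper_scaledChart_data M g cov T hT hflow hRiem δ C t₀ hδ ht₀ hrate hdec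
  have hbounds := helper_scaledChart_bounds M g cov T hT hflow hRiem hdata
  obtain ⟨g', hg', hconv⟩ := helper_scaledLimit_metric M g cov T hT hflow hRiem hbounds
  exact ⟨1 / 6, g', by norm_num, hg',
    helper_scaledLimit_round M g cov T hT hflow hRiem δ C t₀ hδ ht₀ hrate g' hg' hconv⟩

end Literature.Geometry.Riemannian.HamiltonPinchedFlow

end Part9

/-!
## Part 10 — port of `Summits/SmoothPoincare4/SmoothPoincare4/Theorems/EntropyRungChangGurskyYangOfBlowupLimit.lean` (2 declarations kept)

# From Hamilton's explicit pinching set to the tree's pinching sets: `rpow` monotonicity and `mem_pinchingSet_of_hamiltonSet`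

Declarations of this Part (verbatim port; each keeps its own docstring and citation): `rpow_pinching_mono`, `mem_pinchingSet_of_hamiltonSet`.

References: R. S. Hamilton, *Four-manifolds with positive curvature operator*, J. Differential Geom. 24 (1986) 153–179 [Hamilton1986]; C. Margerin, *A sharp characterization of the smooth 4-sphere in curvature terms*, Comm. Anal. Geom. 6 (1998) 21–65 [Margerin1998]; P. Topping, *Lectures on the Ricci flow*, LMS Lecture Note Series 325, CUP 2006 [Topping2006]; J. Morgan, G. Tian, *Ricci Flow and the Poincaré Conjecture*, Clay Math. Monographs 3, AMS 2007 [MorganTian2007].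
-/

section Part10

open _root_.Set _root_.Function _root_.Module _root_.Filter
open scoped _root_.Manifold _root_.ContDiff _root_.Matrix _root_.BigOperators _root_.Topology

namespace Literature.Geometry.Riemannian.HamiltonPinchedFlow

open Literature.Geometry.Riemannian Literature.Geometry.Riemannian.HamiltonODE
open Literature.Geometry.Lorentzian Literature.Geometry.Lorentzian.PseudoRiemannianMetric

/-! ## The chain: pinched flows give a metric of constant positive curvature -/

/-- **Monotonicity of the pinching exponent**: for `0 < m ≤ R`, `z ≤ 0`: `R^z ≤ m^z`, so
`K R^{2−τ} = K R^{2−τ'} R^{τ'−τ} ≤ (K m^{τ'−τ}) R^{2−τ'}` whenever `τ' ≤ τ` (`Real.rpow` algebra).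
[cite: Hamilton1986, §5, 5.2 (p. 164)] -/
theorem rpow_pinching_mono {m R K τ τ' : ℝ} (hm : 0 < m) (hmR : m ≤ R) (hK : 0 ≤ K) (hτ' : τ' ≤ τ) :
    K * R ^ (2 - τ) ≤ K * m ^ (τ' - τ) * R ^ (2 - τ') := by
  have hR : 0 < R := hm.trans_le hmR
  have hsplit : R ^ (2 - τ) = R ^ (2 - τ') * R ^ (τ' - τ) := by
    rw [← Real.rpow_add hR]; ring_nf
  rw [hsplit, mul_assoc, mul_comm (m ^ (τ' - τ))]
  refine mul_le_mul_of_nonneg_left (mul_le_mul_of_nonneg_left ?_ (Real.rpow_nonneg hR.le _)) hK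
  exact Real.antitoneOn_rpow_Ioi_of_exponent_nonpos (by linarith) (mem_Ioi.2 hm) (mem_Ioi.2 hR) hmR

/-- **Hamilton's pinching set of `hamilton_convergenceCriterion_four` lies in a `pinchingSet` with
exponent `≤ 1`**: if the blocks `(A, B, C)` of a Levi-Civita connection in a frame satisfy
`m ≤ tr A + tr C` and `‖A‖² + 2‖B‖² + ‖C‖² − (tr A + tr C)²/6 ≤ K (tr A + tr C)^{2−τ}` (`m, τ > 0`,
`K ≥ 0`), then with `τ' = min τ 1`, `K' = K m^{τ'−τ}`, `c = K' m^{−τ'}` they lie in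
`pinchingSet m c K' τ'`: `A`, `C` are symmetric with `tr A = tr C` (`blockA_isSymm`, `blockC_isSymm`,
`trace_blockA_eq_trace_blockC` — any Levi-Civita connection, any frame), `R ≥ m > 0`, and
`rpow_pinching_mono` twice. [cite: Hamilton1986, §5, Def. 5.1 and 5.2 (pp. 163–164)] -/
theorem mem_pinchingSet_of_hamiltonSet
    {M : Type} [TopologicalSpace M] [ChartedSpace (EuclideanSpace ℝ (Fin 4)) M] [IsManifold (𝓡 4) ∞ M]
    {g : PseudoRiemannianMetric (𝓡 4) ∞ (EuclideanSpace ℝ (Fin 4)) (TangentSpace (𝓡 4) : M → Type _)}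
    [g.HasLeviCivita]
    {cov : CovariantDerivative (𝓡 4) (EuclideanSpace ℝ (Fin 4)) (TangentSpace (𝓡 4) : M → Type _)}
    (hcov : g.IsLeviCivita cov) {m K τ : ℝ} (hm : 0 < m) (hK : 0 ≤ K) (hτ : 0 < τ)
    {x : M} (e : Fin 4 → TangentSpace (𝓡 4) x)
    (hmem : m ≤ (g.blockA cov x e).trace + (g.blockC cov x e).trace ∧
      (∑ i, ∑ j, g.blockA cov x e i j ^ 2) + 2 * (∑ i, ∑ j, g.blockB cov x e i j ^ 2) +
          (∑ i, ∑ j, g.blockC cov x e i j ^ 2) -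
          ((g.blockA cov x e).trace + (g.blockC cov x e).trace) ^ 2 / 6 ≤
        K * ((g.blockA cov x e).trace + (g.blockC cov x e).trace) ^ (2 - τ)) :
    (g.blockA cov x e, g.blockB cov x e, g.blockC cov x e) ∈
      pinchingSet m (K * m ^ (min τ 1 - τ) * m ^ (-min τ 1)) (K * m ^ (min τ 1 - τ)) (min τ 1) := by
  have hn : (2 : ℕ∞ω) ≤ ∞ := WithTop.coe_le_coe.mpr le_top
  obtain ⟨hmR, hdev⟩ := hmem
  set R := (g.blockA cov x e).trace + (g.blockC cov x e).trace with hRdef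
  have hR : 0 < R := hm.trans_le hmR
  have hK' : 0 ≤ K * m ^ (min τ 1 - τ) := mul_nonneg hK (Real.rpow_nonneg hm.le _)
  -- the two scale comparisons
  have h1 : K * R ^ (2 - τ) ≤ K * m ^ (min τ 1 - τ) * R ^ (2 - min τ 1) :=
    rpow_pinching_mono hm hmR hK (min_le_left τ 1)
  have h2 : K * m ^ (min τ 1 - τ) * R ^ (2 - min τ 1) ≤
      K * m ^ (min τ 1 - τ) * m ^ (-min τ 1) * R ^ 2 := by
    have h := rpow_pinching_mono (τ := min τ 1) (τ' := 0) hm hmR hK' (lt_min hτ one_pos).le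
    rw [zero_sub, sub_zero, Real.rpow_two] at h
    exact h
  have hscal : scal (g.blockA cov x e, g.blockB cov x e, g.blockC cov x e) = R := rfl
  have hdev' : devNormSq (g.blockA cov x e, g.blockB cov x e, g.blockC cov x e) =
      (∑ i, ∑ j, g.blockA cov x e i j ^ 2) + 2 * (∑ i, ∑ j, g.blockB cov x e i j ^ 2) +
        (∑ i, ∑ j, g.blockC cov x e i j ^ 2) - R ^ 2 / 6 := rfl
  refine mem_pinchingSet.2 ⟨mem_margerinCone.2 ⟨blockA_isSymm hcov hn x e, blockC_isSymm hcov hn x e,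
    trace_blockA_eq_trace_blockC hcov hn x e, ?_, ?_⟩, ?_, ?_⟩
  · rw [hscal]; exact hR.le
  · rw [hscal, hdev']; exact (hdev.trans h1).trans h2
  · rw [hscal]; exact hmR
  · rw [hscal, hdev']; exact hdev.trans h1

/-! ## Hamilton's convergence criterion from the blow-up limit -/

end Literature.Geometry.Riemannian.HamiltonPinchedFlow

end Part10

/-!
## Part 11 — port of `Summits/SmoothPoincare4/SmoothPoincare4/Theorems/EntropyRungChangGurskyYangFlowLeafClosed.lean` (2 declarations kept)

# Hamilton's convergence criterion 5.2 in dimension four HOLDS: `constantCurvature_of_pinchedFlows_rails` and `hamilton_convergenceCriterion_four_holds` (EXACT name)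

Declarations of this Part (verbatim port; each keeps its own docstring and citation): `constantCurvature_of_pinchedFlows_rails`, `hamilton_convergenceCriterion_four_holds`.

References: R. S. Hamilton, *Four-manifolds with positive curvature operator*, J. Differential Geom. 24 (1986) 153–179 [Hamilton1986]; R. S. Hamilton, *Three-manifolds with positive Ricci curvature*, J. Differential Geom. 17 (1982) 255–306 [Hamilton1982]; C. Margerin, *A sharp characterization of the smooth 4-sphere in curvature terms*, Comm. Anal. Geom. 6 (1998) 21–65 [Margerin1998]; S.-Y. A. Chang, M. J. Gursky, P. C. Yang, *A conformally invariant sphere theorem in four dimensions*, Publ. Math. IHÉS 98 (2003) 105–143 [ChangGurskyYang2003].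
-/

section Part11

open _root_.Set _root_.Function _root_.Filter
open scoped _root_.Manifold _root_.ContDiff _root_.Topology

namespace Literature.Geometry.Riemannian.HamiltonPinchedFlow

open Literature.Geometry.Riemannian
open Literature.Geometry.Lorentzian Literature.Geometry.Lorentzian.PseudoRiemannianMetric

/-- **A pinched Ricci flow on a closed connected 4-manifold yields a metric of constant sectional curvature
`k > 0`** (Hamilton 1986, §5, criterion 5.2 for the sets `pinchingSet m c K τ`, `0 < τ ≤ 1`,
proved along Hamilton's own 1982 argument on the fixed manifold: `stub_maximalFlow` → `stub_invariantPinching` →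
`stub_gradientEstimates` → `stub_curvatureRatio` → `stub_roundnessRate` → `stub_scaledShi` →
`stub_smoothRoundLimit`).
[cite: Hamilton1986, §5, 5.2 (p. 164)] [cite: Hamilton1982, §§11–17] [cite: Margerin1998, Part VI, pp. 53–57] -/
theorem constantCurvature_of_pinchedFlows_rails
    (M : Type) [TopologicalSpace M] [T2Space M] [SecondCountableTopology M]
    [ChartedSpace (EuclideanSpace ℝ (Fin 4)) M] [IsManifold (𝓡 4) ∞ M] [CompactSpace M]
    [ConnectedSpace M]
    (g₀ : PseudoRiemannianMetric (𝓡 4) ∞ (EuclideanSpace ℝ (Fin 4)) (TangentSpace (𝓡 4) : M → Type _))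
    (m c K τ : ℝ) (hg₀ : g₀.IsRiemannian) (hm : 0 < m) (hK : 0 < K) (hτ0 : 0 < τ) (hτ1 : τ ≤ 1)
    (hflows : ∀ (T : ℝ)
        (g : ℝ → PseudoRiemannianMetric (𝓡 4) ∞ (EuclideanSpace ℝ (Fin 4))
          (TangentSpace (𝓡 4) : M → Type _))
        (cov : ℝ → CovariantDerivative (𝓡 4) (EuclideanSpace ℝ (Fin 4))
          (TangentSpace (𝓡 4) : M → Type _)),
        IsRicciFlow g cov (Ico 0 T) → (∀ t ∈ Ico 0 T, (g t).IsRiemannian) → g 0 = g₀ →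
        ∀ t ∈ Ico 0 T, ∀ (x : M) (e : Fin 4 → TangentSpace (𝓡 4) x),
          (g t).IsOrthonormalFrame x e →
            ((g t).blockA (cov t) x e, (g t).blockB (cov t) x e, (g t).blockC (cov t) x e) ∈
              pinchingSet m c K τ) :
    ∃ (k : ℝ) (g' : PseudoRiemannianMetric (𝓡 4) ∞ (EuclideanSpace ℝ (Fin 4))
        (TangentSpace (𝓡 4) : M → Type _)),
      0 < k ∧ g'.IsRiemannian ∧ g'.HasConstantSectionalCurvature k := by
  -- 4a: the maximal flow from `g₀` is finite-time
  obtain ⟨T, g, cov, hmax, h0⟩ := stub_maximalFlow M g₀ m c K τ hg₀ hm hflows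
  have hT : 0 < T := hmax.pos
  -- 4b: the pinching along the maximal flow, in invariant form
  have hpinch : ∀ s ∈ Ico 0 T, ∀ [(g s).HasLeviCivita] (x : M),
      m ≤ (g s).scalarCurvature x ∧
        (g s).weylNormSq x + 2 * (g s).tracelessRicciNormSq x ≤
          K * (g s).scalarCurvature x ^ (2 - τ) := by
    intro s hs _ x
    exact stub_invariantPinching M (g s) (cov s) m c K τ (hmax.isRiemannian s hs)
      (hmax.isRicciFlow.isLeviCivita s hs)
      (fun y e he ↦ hflows T g cov hmax.isRicciFlow hmax.isRiemannian h0 s hs y e he) x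
  -- 4.B1: the gradient estimate (Thm. 11.1) and the gradient decay (Lemma 17.4)
  obtain ⟨hgrad, hdecay⟩ := stub_gradientEstimates M g cov T m K τ hT hm hK hτ0 hτ1 hmax.isRicciFlow
    hmax.isRiemannian hpinch
  -- 4.B2: `R_max / R_min → 1`
  have hratio := stub_curvatureRatio M g cov T m K τ hm hK hτ0 hτ1 hmax hpinch hgrad
  -- 4.B3: Type-I bounds and the roundness rate
  obtain ⟨δ, C, t₀, hδ, -, ht₀, hround⟩ :=
    stub_roundnessRate M g cov T m K τ hm hK hτ0 hτ1 hmax hpinch hdecay hratio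
  -- 4.B4: scaled Shi bounds for this one flow
  have hshi := stub_scaledShi M g cov T hT hmax.isRicciFlow hmax.isRiemannian C t₀ ht₀
    (fun t ht x ↦ (hround t ht x).2.2.2)
  -- 4.B5: smooth convergence of `g(t)/(T−t)` to a round metric
  exact stub_smoothRoundLimit M g cov T hT hmax.isRicciFlow hmax.isRiemannian δ C t₀ hδ ht₀
    (fun t ht x ↦ ⟨(hround t ht x).1, (hround t ht x).2.1, (hround t ht x).2.2.1⟩) hshi

/-- **Hamilton's convergence criterion 5.2 in dimension four HOLDS** — the tree's bespoke named fact
`Literature.Geometry.Riemannian.hamilton_convergenceCriterion_four` (Hamilton 1986, §5, 5.2, vended form: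
along every Ricci flow from `g₀` the blocks stay in `{m ≤ tr A + tr C} ∩ {|M̊|² ≤ K (tr A + tr C)^{2−τ}}`
⇒ `M` carries a `C^∞` Riemannian metric of constant sectional curvature `k > 0`) is PROVED: reduce the exponent
to `τ' = min τ 1 ≤ 1` (`mem_pinchingSet_of_hamiltonSet`, p113080) and run `constantCurvature_of_pinchedFlows_rails`.
This is also hypothesis `h₁` of the tree's reduction of Hamilton's 1986 classification of closed 4-manifolds with
positive curvature operator (`HamiltonPCOClassificationProofs.lean`).
[cite: Hamilton1986, §5, 5.2 Convergence criterion (p. 164)] [cite: Hamilton1982, §§11–17] -/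
theorem _root_.Literature.Geometry.Riemannian.hamilton_convergenceCriterion_four_holds :
    hamilton_convergenceCriterion_four := by
  intro M _ _ _ _ _ _ _ g₀ m K τ hg₀ hm hK hτ hflows
  refine constantCurvature_of_pinchedFlows_rails M g₀ m (K * m ^ (min τ 1 - τ) * m ^ (-min τ 1))
    (K * m ^ (min τ 1 - τ)) (min τ 1) hg₀ hm (mul_pos hK (Real.rpow_pos_of_pos hm _))
    (lt_min hτ one_pos) (min_le_right τ 1) fun T g cov hflow hR h0 t ht x e he ↦ ?_
  haveI := (g t).hasLeviCivita
  exact mem_pinchingSet_of_hamiltonSet (hflow.isLeviCivita t ht) hm hK.le hτ e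
    (hflows T g cov hflow hR h0 t ht x e he)

end Literature.Geometry.Riemannian.HamiltonPinchedFlow

end Part11

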